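import Literature.MathematicalPhysics.QuantumLattice.SpinChains
import Literature.MathematicalPhysics.QuantumLattice.InfiniteVolumeSpinEntriesProofs
import Literature.MathematicalPhysics.QuantumLattice.LiebMattisMatrixElements
import Literature.MathematicalPhysics.QuantumLattice.HeisenbergModelGlobalRotationProofs
import Literature.MathematicalPhysics.QuantumLattice.PerronFrobeniusGroundState
import Literature.MathematicalPhysics.QuantumLattice.SectorSpectrum
import Literature.MathematicalPhysics.QuantumLattice.Su2Multiplet
import HarnessLib

/-!
# The Lieb–Mattis theorem on the ordering of energy levels (discharge of `lieb_mattis_monotone`)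

Trunk T-QLATTICE, family `hubbard` (hubbard.S20). Sibling proof file of
`Literature/MathematicalPhysics/QuantumLattice/SpinChains.lean`: it DISCHARGES the named fact
`Literature.MathematicalPhysics.QuantumLattice.lieb_mattis_monotone` as
`lieb_mattis_monotone_holds : lieb_mattis_monotone n G A J` (E. Lieb, D. Mattis, J. Math. Phys. 3
(1962) 749, Theorem 2; H. Tasaki (2020) Theorem 2.3 and eq. (2.4.7)). No statement of any other file
is changed and no named fact is introduced: the `def`s below are auxiliary notions with bodies
(magnetisation of a configuration, hops, the Marshall-twisted sector block, the ladder operators of a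
set of sites, the Marshall-sign positivity predicate, two-site highest-weight amplitudes, pairings and
the product reference state, the spin flip), each followed by the API that is actually used, and
everything stated is proved.

We follow the proof of Lieb–Mattis (1962) as presented in D. C. Mattis, *The Theory of Magnetism
Made Simple* (2006), §5.10 (held): (1) after the `π`-rotation of the `Aᶜ` spins about the `z`-axis
(Marshall 1955) every off-diagonal matrix element of the bipartite antiferromagnet in the product
basis is `≤ 0`; (2) in each magnetisation subspace `S^z_tot = M` the Hamiltonian connects all basis
states, so (Perron–Frobenius) the lowest state of the subspace is unique and "nodeless"; (3) its
total spin is read off from its overlap with a nodeless reference state of known spin — here an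
explicit product of two-site highest-weight states instead of the ground state of the soluble
reference model `J 𝐒_A·𝐒_B` (same spins `max(S₀, |M|)`, Mattis (2006) eqs. (5.174)–(5.176));
(4) moving ground states between the subspaces with `S^±_tot` orders the energies. Contents:

* §I  `mag`, `S^z_tot` is diagonal (`totalSpin_two_apply`), the sector `spinZSector n M` is the
  coordinate subspace `{σ | mag σ = M}` (`mem_spinZSector_iff`, `spinZSector_ne_bot_iff`); entries of
  `H = J Σ 𝐒_x·𝐒_y` (real and symmetric — `LiebMattis.heisenbergHamiltonian_apply` etc. of
  `LiebMattisMatrixElements.lean` — `≥ 0` off the diagonal, `> 0` on hops, block diagonal in the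
  sectors) and **Marshall's sign rule** `marshallSign_eq_neg_of_apply_ne_zero`.
* §II hops and the **connectivity of the hop graph in each sector** on a connected graph
  (`reflTransGen_isSpinHop`: move one unit along a walk, relaying through full sites), the
  Marshall-twisted sector block `marshallBlock` and **Perron–Frobenius in each sector**:
  `liebMattis_sector_groundState` (existence, variational bound), `liebMattis_sector_unique`
  (uniqueness up to scalars), `liebMattis_sector_pos` (strictly positive Marshall-twisted amplitudes),
  from `PerronFrobeniusGroundState` and `SectorSpectrum`.
* §III the ladder operators `raiseOn/lowerOn/zOn n X = Σ_{x∈X} S^{±,z}_x` of a set of sites satisfy the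
  `su(2)` relations (`isSu2Triple_on`), `(𝐒_tot)² = su2Casimir` (`totalSpinSq_eq_su2Casimir`),
  commute with `H`; norm identities `‖S^∓v‖² = (S(S+1) - M(M∓1))‖v‖²` and their consequences
  (`lowerOn_pow_mulVec`, `raiseOn_pow_mulVec`), and `totalSpinSq_mulVec_of_highest` (a highest-weight
  vector of weight `M` has spin `M`).
* §IV a sector ground state is an eigenvector of `(𝐒_tot)²` (`exists_totalSpinSq_mulVec_eq_smul`),
  eigenvectors of a Hermitian matrix with different eigenvalues are orthogonal
  (`eigenvalue_eq_of_dotProduct_ne_zero`), and a Marshall-nonnegative vector overlaps the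
  Marshall-positive ground state (`dotProduct_ne_zero_of_marshall`).
* §V  **Reference states.** The two-site highest-weight vector of spin `j` in `(spin n/2)^{⊗2}`
  (`pairAmp`, moduli `hwAbs` by the recursion forced by `S⁺`, sign `(-1)^k` on the `A`-site =
  Marshall sign): `pairAmp_raise`, `pairAmp_lower` (the singlet is lowest weight too). Pair each site
  `b ∈ Aᶜ` with `e b ∈ A` (`IsPairing`, exists iff `|Aᶜ| ≤ |A|`) and form the product state `refVec`
  = pair states of spins `j_b` ⊗ up-spins on the unpaired sites of `A` (`LiebMattis.onSite_mulVec_apply` is how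
  `S^±_x` acts on amplitudes): a highest-weight vector (`raiseOn_mulVec_refVec`) of weight
  `S₀ + Σ_b j_b`, `S₀ = (|A| - |Aᶜ|) n/2` (`refVec_mem_spinZSector`), nonzero, Marshall-nonnegative
  (`isMarshallNonneg_refVec`); for the singlet reference, powers of `S⁻_tot` act only through the
  unpaired spins (`lowerOn_univ_pow_mulVec_refVec`) and `(-S⁻_F)^k` keeps the Marshall sign.
* §VI `totalSpinSq_mulVec_groundState`: for `|Aᶜ| ≤ |A|` the ground state of the sector `M ≥ 0` has
  `(𝐒_tot)² = S(S+1)`, `S = max(S₀, M)`.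
* §VII energies: variational transfer between sectors by `(S^±_tot)^k` (`lowestEnergy_sub_le`,
  `lowestEnergy_add_le`), spin-flip symmetry `E(-M) = E(M)` (`flipCfg`, `lowestEnergy_neg`), a ground
  state has a nonzero component in some sector (`exists_sector_groundState_nonneg`), the strict step
  `E(M) < E(M+1)` for `M ≥ S₀` (`lowestEnergy_lt_add_one`), `E(M) = E₀` for `0 ≤ M ≤ S₀`
  (`lowestEnergy_eq_groundEnergy`); §VIII the discharge (the case `|A| < |Aᶜ|` by exchanging the
  sublattices).

## References

* E. Lieb, D. Mattis, *Ordering energy levels of interacting spin systems*, J. Math. Phys. 3 (1962)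
  749–751, Theorem 2 and its proof. [LiebMattis1962]
* W. Marshall, *Antiferromagnetism*, Proc. R. Soc. A 232 (1955) 48. [Marshall1955]
* D. C. Mattis, *The Theory of Magnetism Made Simple* (World Scientific, 2006), §5.10,
  eqs. (5.173)–(5.177) (held: book:mattis2006-…, PDF pp. 230–232); §5.6 (PDF p. 209), theorem (1).
* H. Tasaki, *Physics and Mathematics of Quantum Many-Body Systems* (Springer, 2020), §2.4,
  Theorem 2.3, eqs. (2.4.5)–(2.4.7), App. A.3. [Tasaki2020]
* E. H. Lieb, F. Y. Wu, Physica A 321 (2003) 1, §2 (the Perron–Frobenius argument as formalised in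
  `PerronFrobeniusGroundState`). [LiebWuPhysicaA2003]
-/

noncomputable section

open Matrix Complex Finset
open scoped ComplexOrder

namespace Literature.MathematicalPhysics.QuantumLattice

section Sector

variable {Λ : Type*} [Fintype Λ] [DecidableEq Λ] (n : ℕ)

/-! ### Magnetisation of a configuration; `S^z_tot` is diagonal -/

/-- The magnetisation `mag n σ = Σ_x m_x = Σ_x (n/2 - σ_x)` of a basis configuration `σ` (the
eigenvalue of `S^z_tot` on `|σ⟩`). Tasaki (2020) §2.2, eq. (2.2.11); Lieb–Mattis (1962) §II. [folklore] -/
def mag (σ : TensorIndex Λ (n + 1)) : ℝ :=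
  ∑ x, ((n : ℝ) / 2 - ((σ x : ℕ) : ℝ))

/-- Entries of a single-site *diagonal* operator: `⟨σ| onSite x (diagonal d) |τ⟩ = [σ = τ] d (σ x)`.
Tasaki (2020) §2.2, eq. (2.2.5). [folklore] -/
theorem onSite_diagonal_apply {q : ℕ} (x : Λ) (d : Fin q → ℂ) (σ τ : TensorIndex Λ q) :
    (onSite x (diagonal d) : Op Λ q) σ τ = if σ = τ then d (σ x) else 0 := by
  rw [onSite_apply, diagonal_apply]
  by_cases h : σ = τ
  · subst h
    simp
  · rw [if_neg h]
    split_ifs with h1 h2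
    · exact absurd (funext fun y => if hy : y = x then hy ▸ h2 else h1 y hy) h
    · rfl
    · rfl

/-- `S^z_x` is diagonal in the product basis with entry `n/2 - σ_x`. Tasaki (2020) §2.2,
eq. (2.2.5). [folklore] -/
theorem siteSpin_two_apply (x : Λ) (σ τ : TensorIndex Λ (n + 1)) :
    (siteSpin n x 2 : Op Λ (n + 1)) σ τ =
      if σ = τ then ((n : ℂ) / 2 - ((σ x : ℕ) : ℂ)) else 0 := by
  rw [siteSpin, spinVec_two, SpinOperators.spinZ, onSite_diagonal_apply]

/-- **`S^z_tot` is diagonal** in the product basis, with entries the magnetisations: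
`⟨σ| S^z_tot |τ⟩ = [σ = τ] mag n σ`. Tasaki (2020) §2.2, eq. (2.2.11). [folklore] -/
theorem totalSpin_two_apply (σ τ : TensorIndex Λ (n + 1)) :
    (totalSpin n 2 : Op Λ (n + 1)) σ τ = if σ = τ then ((mag n σ : ℝ) : ℂ) else 0 := by
  rw [totalSpin, Matrix.sum_apply]
  simp only [siteSpin_two_apply]
  split_ifs with h
  · rw [mag]
    push_cast
    rfl
  · simp

/-- `S^z_tot` acts diagonally: `(S^z_tot v)(σ) = mag(σ) v(σ)`. Tasaki (2020) §2.2, eq. (2.2.11). [folklore] -/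
theorem totalSpin_two_mulVec_apply (v : TensorIndex Λ (n + 1) → ℂ) (σ : TensorIndex Λ (n + 1)) :
    ((totalSpin n 2 : Op Λ (n + 1)) *ᵥ v) σ = ((mag n σ : ℝ) : ℂ) * v σ := by
  rw [mulVec, dotProduct, Finset.sum_eq_single σ]
  · rw [totalSpin_two_apply, if_pos rfl]
  · intro τ _ hτ
    rw [totalSpin_two_apply, if_neg (Ne.symm hτ), zero_mul]
  · intro h
    exact absurd (Finset.mem_univ σ) h

/-- **The magnetisation sector is a coordinate subspace**: `v ∈ 𝓗_M` iff `v` is supported on the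
configurations of magnetisation `M`. Tasaki (2020) §2.4, eq. (2.4.5); Lieb–Mattis (1962) §II. [folklore] -/
theorem mem_spinZSector_iff (M : ℝ) (v : TensorIndex Λ (n + 1) → ℂ) :
    v ∈ spinZSector (Λ := Λ) n M ↔ ∀ σ, mag n σ ≠ M → v σ = 0 := by
  rw [spinZSector, Module.End.mem_eigenspace_iff, Matrix.toLin'_apply]
  constructor
  · intro h σ hσ
    have h1 := congrFun h σ
    rw [totalSpin_two_mulVec_apply, Pi.smul_apply, smul_eq_mul] at h1
    have h2 : (((mag n σ : ℝ) : ℂ) - (M : ℂ)) * v σ = 0 := by rw [sub_mul, h1, sub_self]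
    rcases mul_eq_zero.1 h2 with h3 | h3
    · exact absurd (by exact_mod_cast sub_eq_zero.1 h3) hσ
    · exact h3
  · intro h
    funext σ
    rw [totalSpin_two_mulVec_apply, Pi.smul_apply, smul_eq_mul]
    by_cases hσ : mag n σ = M
    · rw [hσ]
    · rw [h σ hσ, mul_zero, mul_zero]

/-- The basis vector `|σ⟩` (indicator of `σ`) lies in the sector of magnetisation `mag n σ`. [folklore] -/
theorem single_mem_spinZSector (σ : TensorIndex Λ (n + 1)) :
    (Pi.single σ (1 : ℂ) : TensorIndex Λ (n + 1) → ℂ) ∈ spinZSector (Λ := Λ) n (mag n σ) := by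
  rw [mem_spinZSector_iff]
  intro τ hτ
  rw [Pi.single_apply, if_neg]
  rintro rfl
  exact hτ rfl

/-- **Allowed magnetisations**: the sector `𝓗_M` is nonzero iff some configuration has
magnetisation `M` (i.e. `M ∈ {-|Λ|n/2, …, |Λ|n/2}`). Tasaki (2020) §2.4. [folklore] -/
theorem spinZSector_ne_bot_iff (M : ℝ) :
    spinZSector (Λ := Λ) n M ≠ ⊥ ↔ ∃ σ : TensorIndex Λ (n + 1), mag n σ = M := by
  constructor
  · intro h
    obtain ⟨v, hv, hv0⟩ := (Submodule.ne_bot_iff _).1 h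
    obtain ⟨σ, hσ⟩ := Function.ne_iff.1 hv0
    rw [mem_spinZSector_iff] at hv
    by_contra hc
    push Not at hc
    exact hσ (hv σ (hc σ))
  · rintro ⟨σ, rfl⟩
    rw [Submodule.ne_bot_iff]
    exact ⟨_, single_mem_spinZSector n σ, fun h => one_ne_zero (α := ℂ) (by simpa using congrFun h σ)⟩

/-! ### Entries of the Heisenberg Hamiltonian -/

section Graph

variable (G : SimpleGraph Λ) [DecidableRel G.Adj] (J : ℝ)

/-- The entries of `𝐒_x·𝐒_y` (`x ≠ y`) are real. Tasaki (2020) §2.4, eq. (2.4.1). [folklore] -/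
theorem spinDot_apply_im {x y : Λ} (hxy : x ≠ y) (σ τ : TensorIndex Λ (n + 1)) :
    (spinDot n x y σ τ).im = 0 := by
  rw [spinDot_apply_of_ne n hxy]
  split_ifs
  · simp only [spinRaise_apply, spinLower_apply, spinZ_apply, Complex.add_im, Complex.mul_im]
    split_ifs <;> simp
  · rfl

/-- The entries of an edge term `𝐒·𝐒_e`, `e ∈ E(G)`, are real (edges join distinct sites). [folklore] -/
theorem spinDotSym_apply_im {e : Sym2 Λ} (he : e ∈ G.edgeFinset) (σ τ : TensorIndex Λ (n + 1)) :
    (spinDotSym n e σ τ).im = 0 := by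
  revert he
  refine Sym2.ind (fun x y hxy => ?_) e
  rw [SimpleGraph.mem_edgeFinset, SimpleGraph.mem_edgeSet] at hxy
  rw [spinDotSym_mk]
  exact spinDot_apply_im n (G.ne_of_adj hxy) σ τ

/-- **The Heisenberg Hamiltonian has real entries** in the product basis. Lieb–Mattis (1962),
proof of Thm 2; Tasaki (2020) §2.4. [folklore] -/
theorem heisenberg_apply_im (σ τ : TensorIndex Λ (n + 1)) :
    (heisenbergHamiltonian n G J σ τ).im = 0 := by
  rw [LiebMattis.heisenbergHamiltonian_apply, Complex.mul_im, Complex.ofReal_re, Complex.ofReal_im, zero_mul, add_zero,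
    Complex.im_sum, Finset.sum_eq_zero fun e he => spinDotSym_apply_im n G he σ τ, mul_zero]

/-- Off the diagonal, the entries of `𝐒_x·𝐒_y` (`x ≠ y`) are nonnegative reals: only the
"flip-flop" terms `½(S⁺_x S⁻_y + S⁻_x S⁺_y)` contribute, with entries `√· √· ≥ 0`.
Lieb–Mattis (1962), proof of Thm 2; Mattis (2006) §5.10, eq. (5.173). [folklore] -/
theorem spinDot_apply_re_nonneg {x y : Λ} (hxy : x ≠ y) {σ τ : TensorIndex Λ (n + 1)}
    (hστ : σ ≠ τ) : 0 ≤ (spinDot n x y σ τ).re := by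
  rw [spinDot_apply_of_ne n hxy]
  split_ifs with hc
  · have hZ : SpinOperators.spinZ n (σ x) (τ x) * SpinOperators.spinZ n (σ y) (τ y) = 0 := by
      by_contra h
      obtain ⟨h1, h2⟩ := mul_ne_zero_iff.1 h
      have e1 := spinZ_apply_ne_zero n h1
      have e2 := spinZ_apply_ne_zero n h2
      exact hστ (funext fun z => if hzx : z = x then hzx ▸ e1 else
        if hzy : z = y then hzy ▸ e2 else hc z hzx hzy)
    rw [hZ, add_zero]
    simp only [spinRaise_apply, spinLower_apply, Complex.mul_re, Complex.add_re, Complex.add_im,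
      Complex.mul_im]
    split_ifs <;> simp <;> positivity
  · simp

/-- Off the diagonal, the entries of an edge term are nonnegative reals. [folklore] -/
theorem spinDotSym_apply_re_nonneg {e : Sym2 Λ} (he : e ∈ G.edgeFinset)
    {σ τ : TensorIndex Λ (n + 1)} (hστ : σ ≠ τ) : 0 ≤ (spinDotSym n e σ τ).re := by
  revert he
  refine Sym2.ind (fun x y hxy => ?_) e
  rw [SimpleGraph.mem_edgeFinset, SimpleGraph.mem_edgeSet] at hxy
  rw [spinDotSym_mk]
  exact spinDot_apply_re_nonneg n (G.ne_of_adj hxy) hστ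

/-- **Off-diagonal entries of the antiferromagnet are `≥ 0`** (`J ≥ 0`) in the product basis.
Lieb–Mattis (1962), proof of Thm 2; Mattis (2006) §5.10. [folklore] -/
theorem heisenberg_apply_re_nonneg (hJ : 0 ≤ J) {σ τ : TensorIndex Λ (n + 1)} (hστ : σ ≠ τ) :
    0 ≤ (heisenbergHamiltonian n G J σ τ).re := by
  rw [LiebMattis.heisenbergHamiltonian_apply, Complex.re_ofReal_mul, Complex.re_sum]
  exact mul_nonneg hJ (Finset.sum_nonneg fun e he => spinDotSym_apply_re_nonneg n G he hστ)

/-- **Hops have positive amplitude.** If `τ` is obtained from `σ` by moving one unit of `S^z`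
across the edge `{x, y}` (`σ_x = τ_x + 1`, `τ_y = σ_y + 1` in the labels `k = S - m`, all other
sites unchanged), then `Re ⟨σ|H|τ⟩ > 0` for `J > 0`: the term `½ S⁻_x S⁺_y` of the edge `{x,y}`
contributes `½ √(σ_x (n - τ_x)) √((σ_y + 1)(n - σ_y)) > 0` and all other terms are `≥ 0`.
Lieb–Mattis (1962), proof of Thm 2. [folklore] -/
theorem heisenberg_apply_re_pos_of_hop (hJ : 0 < J) {x y : Λ} (hxy : G.Adj x y)
    {σ τ : TensorIndex Λ (n + 1)} (hoff : ∀ z, z ≠ x → z ≠ y → σ z = τ z)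
    (hx : (σ x).val = (τ x).val + 1) (hy : (τ y).val = (σ y).val + 1) :
    0 < (heisenbergHamiltonian n G J σ τ).re := by
  have hne : x ≠ y := G.ne_of_adj hxy
  have hστ : σ ≠ τ := fun h => by rw [h] at hx; omega
  have he : s(x, y) ∈ G.edgeFinset := by
    rw [SimpleGraph.mem_edgeFinset, SimpleGraph.mem_edgeSet]; exact hxy
  rw [LiebMattis.heisenbergHamiltonian_apply, Complex.re_ofReal_mul, Complex.re_sum]
  refine mul_pos hJ ?_
  rw [← Finset.add_sum_erase _ _ he]
  refine add_pos_of_pos_of_nonneg ?_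
    (Finset.sum_nonneg fun e he' => spinDotSym_apply_re_nonneg n G (Finset.mem_of_mem_erase he') hστ)
  rw [spinDotSym_mk, spinDot_apply_of_ne n hne, if_pos hoff]
  -- only `S⁻_x S⁺_y` survives
  have hP : spinRaise n (σ x) (τ x) = 0 := by
    rw [spinRaise_apply, if_neg]; omega
  have hZ : SpinOperators.spinZ n (σ x) (τ x) = 0 := by
    rw [spinZ_apply, if_neg]; intro h; rw [h] at hx; omega
  have hM : spinLower n (σ x) (τ x) = (Real.sqrt (((τ x).val + 1 : ℝ) * (n - (τ x).val : ℝ)) : ℂ) := by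
    rw [spinLower_apply, if_pos hx]
  have hP' : spinRaise n (σ y) (τ y) = (Real.sqrt (((σ y).val + 1 : ℝ) * (n - (σ y).val : ℝ)) : ℂ) := by
    rw [spinRaise_apply, if_pos hy]
  rw [hP, hZ, hM, hP', zero_mul, zero_add, zero_mul, add_zero]
  have h1 : (0 : ℝ) < Real.sqrt (((τ x).val + 1 : ℝ) * (n - (τ x).val : ℝ)) := by
    apply Real.sqrt_pos.2
    have : (τ x).val + 1 ≤ n := by have := (σ x).isLt; omega
    have : ((τ x).val : ℝ) + 1 ≤ n := by exact_mod_cast this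
    exact mul_pos (by positivity) (by linarith)
  have h2 : (0 : ℝ) < Real.sqrt (((σ y).val + 1 : ℝ) * (n - (σ y).val : ℝ)) := by
    apply Real.sqrt_pos.2
    have : (σ y).val + 1 ≤ n := by have := (τ y).isLt; omega
    have : ((σ y).val : ℝ) + 1 ≤ n := by exact_mod_cast this
    exact mul_pos (by positivity) (by linarith)
  have : ((1 : ℂ) / 2 * ((Real.sqrt (((τ x).val + 1 : ℝ) * (n - (τ x).val : ℝ)) : ℂ) *
      (Real.sqrt (((σ y).val + 1 : ℝ) * (n - (σ y).val : ℝ)) : ℂ))).re =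
      1 / 2 * (Real.sqrt (((τ x).val + 1 : ℝ) * (n - (τ x).val : ℝ)) *
        Real.sqrt (((σ y).val + 1 : ℝ) * (n - (σ y).val : ℝ))) := by
    rw [← Complex.ofReal_mul]
    norm_num [Complex.mul_re]
  rw [this]
  positivity

/-! ### Sectors are invariant -/

/-- **`H` preserves the magnetisation sectors**: `⟨σ|H|τ⟩ = 0` unless `mag σ = mag τ`
(`[H, S^z_tot] = 0` and `S^z_tot` is diagonal with entries `mag`). Lieb–Mattis (1962) §II;
Tasaki (2020) §2.4. [folklore] -/
theorem heisenberg_apply_eq_zero_of_mag_ne {σ τ : TensorIndex Λ (n + 1)} (h : mag n σ ≠ mag n τ) :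
    heisenbergHamiltonian n G J σ τ = 0 := by
  have hc := (commute_heisenbergHamiltonian_totalSpin n G J 2).eq
  have h1 := congrFun (congrFun hc σ) τ
  rw [Matrix.mul_apply, Matrix.mul_apply, Finset.sum_eq_single τ, Finset.sum_eq_single σ,
    totalSpin_two_apply, if_pos rfl, totalSpin_two_apply, if_pos rfl] at h1
  · have h2 : (((mag n τ : ℝ) : ℂ) - ((mag n σ : ℝ) : ℂ)) * heisenbergHamiltonian n G J σ τ = 0 := by
      rw [sub_mul, ← h1]; ring
    rcases mul_eq_zero.1 h2 with h3 | h3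
    · exact absurd (by exact_mod_cast (sub_eq_zero.1 h3).symm) h
    · exact h3
  · intro ρ _ hρ; rw [totalSpin_two_apply, if_neg (Ne.symm hρ), zero_mul]
  · intro hσ; exact absurd (Finset.mem_univ σ) hσ
  · intro ρ _ hρ; rw [totalSpin_two_apply, if_neg (Ne.symm hρ).symm, mul_zero]
  · intro hτ; exact absurd (Finset.mem_univ τ) hτ

/-- `H` maps each sector into itself (vector form). [folklore] -/
theorem heisenberg_mulVec_mem_spinZSector {M : ℝ} {v : TensorIndex Λ (n + 1) → ℂ}
    (hv : v ∈ spinZSector (Λ := Λ) n M) :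
    heisenbergHamiltonian n G J *ᵥ v ∈ spinZSector (Λ := Λ) n M := by
  rw [mem_spinZSector_iff] at hv ⊢
  intro σ hσ
  rw [mulVec, dotProduct]
  refine Finset.sum_eq_zero fun τ _ => ?_
  by_cases hτ : mag n τ = M
  · rw [heisenberg_apply_eq_zero_of_mag_ne n G J (by rw [hτ]; exact hσ), zero_mul]
  · rw [hv τ hτ, mul_zero]

/-! ### The Marshall sign -/

omit [Fintype Λ] [DecidableEq Λ] in
/-- `marshallSign A σ = ±1` squares to one. Marshall (1955). [folklore] -/
theorem marshallSign_mul_self {q : ℕ} (A : Finset Λ) (σ : TensorIndex Λ q) :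
    marshallSign A σ * marshallSign A σ = 1 := by
  rw [marshallSign, ← pow_add, ← two_mul, pow_mul]
  norm_num

omit [Fintype Λ] [DecidableEq Λ] in
/-- `marshallSign A σ` is real: `star` fixes it. [folklore] -/
theorem star_marshallSign {q : ℕ} (A : Finset Λ) (σ : TensorIndex Λ q) :
    star (marshallSign A σ) = marshallSign A σ := by
  rw [marshallSign, star_pow, star_neg, star_one]

omit [Fintype Λ] [DecidableEq Λ] in
/-- `marshallSign A σ ≠ 0`. [folklore] -/
theorem marshallSign_ne_zero {q : ℕ} (A : Finset Λ) (σ : TensorIndex Λ q) :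
    marshallSign A σ ≠ 0 :=
  pow_ne_zero _ (neg_ne_zero.2 one_ne_zero)

omit [Fintype Λ] [DecidableEq Λ] in
/-- The Marshall sign as a real sign: `marshallSign A σ = (-1 : ℝ)^{Σ_{x∈A} σ_x}` cast to `ℂ`. [folklore] -/
theorem marshallSign_eq_ofReal {q : ℕ} (A : Finset Λ) (σ : TensorIndex Λ q) :
    marshallSign A σ = (((-1 : ℝ) ^ (∑ x ∈ A, (σ x : ℕ)) : ℝ) : ℂ) := by
  rw [marshallSign]; push_cast; rfl

variable {G}

/-- **Marshall's sign rule for the matrix elements.** On a bipartite graph with parts `A`, `Aᶜ`,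
a nonzero off-diagonal entry `⟨σ|H|τ⟩ ≠ 0`, `σ ≠ τ`, joins configurations of opposite Marshall
sign: the entry comes from a flip-flop `S^±_x S^∓_y` across an edge `{x, y}`, exactly one of whose
endpoints lies in `A`, so `Σ_{x ∈ A} σ_x` changes by one. Equivalently, after the `π`-rotation of
the `Aᶜ` spins about the `z`-axis all off-diagonal elements of `H` are `≤ 0`. Marshall (1955);
Lieb–Mattis (1962), proof of Thm 2; Mattis (2006) §5.10, eq. (5.173); Tasaki (2020) §2.4,
proof of Thm 2.3. [cite: Marshall1955] -/
theorem marshallSign_eq_neg_of_apply_ne_zero {A : Finset Λ}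
    (hA : G.IsBipartiteWith (A : Set Λ) (↑A)ᶜ) {σ τ : TensorIndex Λ (n + 1)} (hστ : σ ≠ τ)
    (h : heisenbergHamiltonian n G J σ τ ≠ 0) : marshallSign A τ = -marshallSign A σ := by
  rw [LiebMattis.heisenbergHamiltonian_apply] at h
  obtain ⟨e, he, hne⟩ : ∃ e ∈ G.edgeFinset, spinDotSym n e σ τ ≠ 0 := by
    by_contra hc
    push Not at hc
    exact h (by rw [Finset.sum_eq_zero hc, mul_zero])
  revert he hne
  refine Sym2.ind (fun x y hxy hne => ?_) e
  rw [SimpleGraph.mem_edgeFinset, SimpleGraph.mem_edgeSet] at hxy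
  rw [spinDotSym_mk] at hne
  have hxy' : x ≠ y := G.ne_of_adj hxy
  obtain ⟨hoff, hcase⟩ := spinDot_apply_ne_zero n hxy' hne
  -- exactly one endpoint is in `A`
  have hbip : (x ∈ A ∧ y ∉ A) ∨ (x ∉ A ∧ y ∈ A) := by
    rcases hA.mem_of_adj hxy with ⟨h1, h2⟩ | ⟨h1, h2⟩
    · exact Or.inl ⟨h1, h2⟩
    · exact Or.inr ⟨h1, h2⟩
  -- the `A`-sums of `σ` and `τ` differ by one
  have key : ∀ {u w : Λ}, u ∈ A → w ∉ A → (∀ z, z ≠ u → z ≠ w → σ z = τ z) →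
      ((τ u).val = (σ u).val + 1 ∨ (σ u).val = (τ u).val + 1) →
      marshallSign A τ = -marshallSign A σ := by
    intro u w hu hw hoff' hu'
    have hsum : ∀ ρ : TensorIndex Λ (n + 1), ∑ z ∈ A, (ρ z : ℕ) = (ρ u : ℕ) + ∑ z ∈ A.erase u, (ρ z : ℕ) :=
      fun ρ => (Finset.add_sum_erase A (fun z => (ρ z : ℕ)) hu).symm
    have hrest : ∑ z ∈ A.erase u, (τ z : ℕ) = ∑ z ∈ A.erase u, (σ z : ℕ) := by
      refine Finset.sum_congr rfl fun z hz => ?_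
      have hzu : z ≠ u := Finset.ne_of_mem_erase hz
      have hzw : z ≠ w := fun h => hw (h ▸ Finset.mem_of_mem_erase hz)
      rw [hoff' z hzu hzw]
    rw [marshallSign, marshallSign, hsum τ, hsum σ, hrest]
    rcases hu' with h1 | h1
    · rw [h1, pow_add, pow_add, pow_succ]; ring
    · rw [h1, pow_add, pow_add, pow_succ]; ring
  rcases hcase with ⟨h1, h2⟩ | ⟨h1, h2⟩ | ⟨h1, h2⟩
  · exact absurd (funext fun z => if hzx : z = x then hzx ▸ h1 else
      if hzy : z = y then hzy ▸ h2 else hoff z hzx hzy) hστ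
  · rcases hbip with ⟨hxA, hyA⟩ | ⟨hxA, hyA⟩
    · exact key hxA hyA hoff (Or.inl h1)
    · exact key hyA hxA (fun z hz1 hz2 => hoff z hz2 hz1) (Or.inr h2)
  · rcases hbip with ⟨hxA, hyA⟩ | ⟨hxA, hyA⟩
    · exact key hxA hyA hoff (Or.inr h1)
    · exact key hyA hxA (fun z hz1 hz2 => hoff z hz2 hz1) (Or.inl h2)

end Graph

end Sector

/-! ## II. Connectivity of the hop graph in a sector, and Perron–Frobenius in each sector -/

section Hops

variable {Λ : Type*} [Fintype Λ] [DecidableEq Λ] {n : ℕ} (G : SimpleGraph Λ)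

/-- A **hop**: `τ` arises from `σ` by moving one unit of the label `k = S - m` from `x` to `y`
across an edge `{x, y}` of `G` (`σ_x = τ_x + 1`, `τ_y = σ_y + 1`, all other sites unchanged), i.e.
by one application of the flip-flop term `S⁻_x S⁺_y` hidden in `𝐒_x·𝐒_y`. Lieb–Mattis (1962),
proof of Thm 2 (the configurations connected by the Hamiltonian). [folklore] -/
def IsSpinHop (σ τ : TensorIndex Λ (n + 1)) : Prop :=
  ∃ x y, G.Adj x y ∧ (∀ z, z ≠ x → z ≠ y → σ z = τ z) ∧
    (σ x).val = (τ x).val + 1 ∧ (τ y).val = (σ y).val + 1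

omit [Fintype Λ] in
/-- The configuration after a hop from `x` to `y` (`x ≠ y`, `σ_x ≥ 1`, `σ_y + 1 ≤ n`). [folklore] -/
theorem exists_hop {x y : Λ} (hxy : x ≠ y) (σ : TensorIndex Λ (n + 1)) (hx : 1 ≤ (σ x).val)
    (hy : (σ y).val + 1 ≤ n) :
    ∃ τ : TensorIndex Λ (n + 1), (∀ z, z ≠ x → z ≠ y → σ z = τ z) ∧
      (σ x).val = (τ x).val + 1 ∧ (τ y).val = (σ y).val + 1 := by
  refine ⟨Function.update (Function.update σ x ⟨(σ x).val - 1, by omega⟩) y ⟨(σ y).val + 1, by omega⟩,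
    fun z hzx hzy => ?_, ?_, ?_⟩
  · rw [Function.update_of_ne hzy, Function.update_of_ne hzx]
  · rw [Function.update_of_ne hxy, Function.update_self]
    change (σ x).val = (σ x).val - 1 + 1
    omega
  · rw [Function.update_self]

omit [Fintype Λ] in
/-- **Transfer along a walk.** If `σ_x ≥ 1`, `σ_y + 1 ≤ n` and `x ≠ y` are joined by a walk of `G`,
one unit can be moved from `x` to `y` by a chain of hops (inner sites are only used as relays:
if the next site is full, first push one of its units onward, then refill it). This is the
connectivity of the configurations used in the Perron–Frobenius step of Lieb–Mattis (1962),
proof of Thm 2 ("connected lattice"). [folklore] -/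
theorem exists_transfer_of_walk {x y : Λ} (w : G.Walk x y) (hxy : x ≠ y)
    (σ : TensorIndex Λ (n + 1)) (hx : 1 ≤ (σ x).val) (hy : (σ y).val + 1 ≤ n) :
    ∃ τ : TensorIndex Λ (n + 1), Relation.ReflTransGen (IsSpinHop G) σ τ ∧
      (∀ z, z ≠ x → z ≠ y → σ z = τ z) ∧ (σ x).val = (τ x).val + 1 ∧ (τ y).val = (σ y).val + 1 := by
  induction w generalizing σ with
  | nil => exact absurd rfl hxy
  | @cons u v w' huv p ih =>
    by_cases hvw : v = w'
    · subst hvw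
      obtain ⟨τ, hoff, h1, h2⟩ := exists_hop hxy σ hx hy
      exact ⟨τ, Relation.ReflTransGen.single ⟨u, v, huv, hoff, h1, h2⟩, hoff, h1, h2⟩
    · have huv' : u ≠ v := huv.ne
      by_cases hv : (σ v).val + 1 ≤ n
      · -- hop `u → v` first, then transfer `v → w'`
        obtain ⟨σ₁, hoff₁, h1₁, h2₁⟩ := exists_hop huv' σ hx hv
        have hx₁ : 1 ≤ (σ₁ v).val := by omega
        have hy₁ : (σ₁ w').val + 1 ≤ n := by rw [← hoff₁ w' hxy.symm (Ne.symm hvw)]; exact hy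
        obtain ⟨τ, hτ, hoff, h1, h2⟩ := ih hvw σ₁ hx₁ hy₁
        refine ⟨τ, Relation.ReflTransGen.head ⟨u, v, huv, hoff₁, h1₁, h2₁⟩ hτ, fun z hzu hzw => ?_, ?_, ?_⟩
        · by_cases hzv : z = v
          · subst hzv; omega
          · rw [hoff₁ z hzu hzv, hoff z hzv hzw]
        · rw [h1₁, hoff u huv' hxy]
        · rw [h2, hoff₁ w' hxy.symm (Ne.symm hvw)]
      · -- `v` is full: transfer `v → w'` first, then hop `u → v`
        have hvn : (σ v).val = n := by have := (σ v).isLt; omega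
        have hx' : 1 ≤ (σ v).val := by have := (σ u).isLt; omega
        obtain ⟨τ₁, hτ₁, hoff₁, h1₁, h2₁⟩ := ih hvw σ hx' hy
        have hxu : 1 ≤ (τ₁ u).val := by rw [← hoff₁ u huv' hxy]; exact hx
        have hvu : (τ₁ v).val + 1 ≤ n := by omega
        obtain ⟨τ, hoff, h1, h2⟩ := exists_hop huv' τ₁ hxu hvu
        refine ⟨τ, hτ₁.tail ⟨u, v, huv, hoff, h1, h2⟩, fun z hzu hzw => ?_, ?_, ?_⟩
        · by_cases hzv : z = v
          · subst hzv; omega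
          · rw [hoff₁ z hzv hzw, hoff z hzu hzv]
        · rw [hoff₁ u huv' hxy, h1]
        · rw [← hoff w' hxy.symm (Ne.symm hvw), h2₁]

/-- The `ℓ¹`-distance between two configurations (in the labels `k`). [folklore] -/
def cfgDist (σ τ : TensorIndex Λ (n + 1)) : ℕ :=
  ∑ z, Int.natAbs (((σ z).val : ℤ) - ((τ z).val : ℤ))

omit [DecidableEq Λ] in
/-- `cfgDist σ τ = 0` iff `σ = τ`. [folklore] -/
theorem cfgDist_eq_zero_iff (σ τ : TensorIndex Λ (n + 1)) : cfgDist σ τ = 0 ↔ σ = τ := by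
  rw [cfgDist, Finset.sum_eq_zero_iff]
  constructor
  · intro h
    funext z
    have := h z (Finset.mem_univ z)
    rw [Int.natAbs_eq_zero, sub_eq_zero] at this
    exact Fin.ext (by exact_mod_cast this)
  · rintro rfl z _
    simp

omit [DecidableEq Λ] in
/-- Two distinct configurations with the same total label have a site where the first is larger.
[folklore] -/
theorem exists_lt_of_sum_eq {σ τ : TensorIndex Λ (n + 1)} (hne : σ ≠ τ)
    (hsum : ∑ z, (σ z).val = ∑ z, (τ z).val) : ∃ x, (τ x).val < (σ x).val := by
  by_contra h
  push Not at h
  have hle : ∀ z ∈ (Finset.univ : Finset Λ), (σ z).val ≤ (τ z).val := fun z _ => h z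
  have := (Finset.sum_eq_sum_iff_of_le hle).1 hsum
  exact hne (funext fun z => Fin.ext (this z (Finset.mem_univ z)))

/-- **The hop graph is connected in each sector** (`G` connected): any two configurations with the
same total label `Σ_x σ_x` (equivalently the same magnetisation) are joined by a chain of hops.
Induction on the `ℓ¹`-distance: move one unit from a site where `σ > τ` to a site where `σ < τ`
along a walk (`exists_transfer_of_walk`). Lieb–Mattis (1962), proof of Thm 2; Tasaki (2020) §2.4,
proof of Thm 2.3 (connectivity ⇒ irreducibility). [folklore] -/
theorem reflTransGen_isSpinHop (hG : G.Connected) (σ τ : TensorIndex Λ (n + 1))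
    (hsum : ∑ z, (σ z).val = ∑ z, (τ z).val) : Relation.ReflTransGen (IsSpinHop G) σ τ := by
  induction hd : cfgDist σ τ using Nat.strong_induction_on generalizing σ with
  | _ d ih =>
    by_cases hne : σ = τ
    · subst hne; exact Relation.ReflTransGen.refl
    obtain ⟨x, hx⟩ := exists_lt_of_sum_eq hne hsum
    obtain ⟨y, hy⟩ := exists_lt_of_sum_eq (Ne.symm hne) hsum.symm
    have hxy : x ≠ y := by rintro rfl; omega
    obtain ⟨w⟩ := hG.preconnected x y
    have hx1 : 1 ≤ (σ x).val := by omega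
    have hy1 : (σ y).val + 1 ≤ n := by have := (τ y).isLt; omega
    obtain ⟨σ', hσ', hoff, h1, h2⟩ := exists_transfer_of_walk G w hxy σ hx1 hy1
    -- the transfer preserves the total label and decreases the distance to `τ`
    have hsum' : ∑ z, (σ' z).val = ∑ z, (τ z).val := by
      rw [← hsum]
      have e1 : ∀ ρ : TensorIndex Λ (n + 1), ∑ z, (ρ z).val =
          (ρ x).val + ((ρ y).val + ∑ z ∈ (Finset.univ.erase x).erase y, (ρ z).val) := by
        intro ρ
        rw [← Finset.add_sum_erase _ _ (Finset.mem_univ x), ← Finset.add_sum_erase _ _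
          (Finset.mem_erase.2 ⟨Ne.symm hxy, Finset.mem_univ y⟩)]
      rw [e1 σ', e1 σ]
      have e2 : ∑ z ∈ (Finset.univ.erase x).erase y, (σ' z).val =
          ∑ z ∈ (Finset.univ.erase x).erase y, (σ z).val := by
        refine Finset.sum_congr rfl fun z hz => ?_
        rw [hoff z (Finset.ne_of_mem_erase (Finset.mem_of_mem_erase hz)) (Finset.ne_of_mem_erase hz)]
      rw [e2]; omega
    have hlt : cfgDist σ' τ < cfgDist σ τ := by
      unfold cfgDist
      apply Finset.sum_lt_sum
      · intro z _
        by_cases hzx : z = x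
        · subst hzx; omega
        · by_cases hzy : z = y
          · subst hzy; omega
          · rw [hoff z hzx hzy]
      · exact ⟨x, Finset.mem_univ x, by omega⟩
    exact hσ'.trans (ih (cfgDist σ' τ) (hd ▸ hlt) σ' hsum' rfl)

omit [DecidableEq Λ] in
/-- Same total label iff same magnetisation. [folklore] -/
theorem mag_eq_mag_iff (σ τ : TensorIndex Λ (n + 1)) :
    mag n σ = mag n τ ↔ ∑ z, (σ z).val = ∑ z, (τ z).val := by
  rw [mag, mag, Finset.sum_sub_distrib, Finset.sum_sub_distrib, sub_right_inj]
  constructor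
  · intro h; exact_mod_cast h
  · intro h; exact_mod_cast congrArg (fun m : ℕ => (m : ℝ)) h

omit [Fintype Λ] [DecidableEq Λ] in
/-- Lifting a chain along a relation preserving a predicate `p` to a chain in the subtype of `p`.
[folklore] -/
theorem reflTransGen_subtype {α : Type*} {r : α → α → Prop} {p : α → Prop}
    (hp : ∀ a b, r a b → p a → p b) {a b : α} (h : Relation.ReflTransGen r a b) (ha : p a) :
    ∃ hb : p b, Relation.ReflTransGen (fun s t : Subtype p => r s.1 t.1) ⟨a, ha⟩ ⟨b, hb⟩ := by
  induction h with
  | refl => exact ⟨ha, Relation.ReflTransGen.refl⟩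
  | @tail b c _ hbc ih =>
    obtain ⟨hb, h⟩ := ih
    exact ⟨hp b c hbc hb, h.tail hbc⟩

/-- A hop preserves the magnetisation. [folklore] -/
theorem IsSpinHop.mag_eq {σ τ : TensorIndex Λ (n + 1)} (h : IsSpinHop G σ τ) : mag n σ = mag n τ := by
  obtain ⟨x, y, hxy, hoff, h1, h2⟩ := h
  have hne : x ≠ y := hxy.ne
  rw [mag_eq_mag_iff]
  have e1 : ∀ ρ : TensorIndex Λ (n + 1), ∑ z, (ρ z).val =
      (ρ x).val + ((ρ y).val + ∑ z ∈ (Finset.univ.erase x).erase y, (ρ z).val) := by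
    intro ρ
    rw [← Finset.add_sum_erase _ _ (Finset.mem_univ x), ← Finset.add_sum_erase _ _
      (Finset.mem_erase.2 ⟨Ne.symm hne, Finset.mem_univ y⟩)]
  rw [e1 σ, e1 τ]
  have e2 : ∑ z ∈ (Finset.univ.erase x).erase y, (σ z).val =
      ∑ z ∈ (Finset.univ.erase x).erase y, (τ z).val := by
    refine Finset.sum_congr rfl fun z hz => ?_
    rw [hoff z (Finset.ne_of_mem_erase (Finset.mem_of_mem_erase hz)) (Finset.ne_of_mem_erase hz)]
  rw [e2]; omega

end Hops

/-! ### Perron–Frobenius in a magnetisation sector -/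

section Perron

variable {Λ : Type*} [Fintype Λ] [DecidableEq Λ] (n : ℕ) (G : SimpleGraph Λ) [DecidableRel G.Adj]
  (A : Finset Λ) (J : ℝ) (M : ℝ)

/-- The **Marshall-twisted sector block** of an operator `H`: the submatrix of
`D H D`, `D = diag(marshallSign A σ)`, on the configurations of magnetisation `M`.
(For the bipartite antiferromagnet its off-diagonal entries are `≤ 0`.) Marshall (1955);
Lieb–Mattis (1962), proof of Thm 2; Mattis (2006) §5.10, eq. (5.173). [folklore] -/
def marshallBlock (H : Op Λ (n + 1)) :
    Matrix {σ : TensorIndex Λ (n + 1) // mag n σ = M} {σ : TensorIndex Λ (n + 1) // mag n σ = M} ℂ :=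
  Matrix.of fun s t => marshallSign A s.1 * H s.1 t.1 * marshallSign A t.1

/-- The Marshall twist of a vector, restricted to the sector: `φ(σ) = marshallSign(σ) v(σ)`. [folklore] -/
def marshallRes (v : TensorIndex Λ (n + 1) → ℂ) : {σ : TensorIndex Λ (n + 1) // mag n σ = M} → ℂ :=
  fun s => marshallSign A s.1 * v s.1

/-- Extension by zero of the (un)twisted sector vector: `v(σ) = marshallSign(σ) φ(σ)` on the sector,
`0` elsewhere. [folklore] -/
def marshallExt (φ : {σ : TensorIndex Λ (n + 1) // mag n σ = M} → ℂ) : TensorIndex Λ (n + 1) → ℂ :=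
  fun σ => if h : mag n σ = M then marshallSign A σ * φ ⟨σ, h⟩ else 0

variable {n A M}

/-- A sum of a function supported in the sector is a sum over the sector. [folklore] -/
theorem sum_eq_sum_sector (f : TensorIndex Λ (n + 1) → ℂ) (hf : ∀ σ, mag n σ ≠ M → f σ = 0) :
    ∑ σ, f σ = ∑ s : {σ : TensorIndex Λ (n + 1) // mag n σ = M}, f s.1 := by
  classical
  exact sum_eq_sum_subtype_of_support (fun σ => mag n σ = M) f hf

/-- `marshallExt φ` lies in the sector. [folklore] -/
theorem marshallExt_mem (φ : {σ : TensorIndex Λ (n + 1) // mag n σ = M} → ℂ) :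
    marshallExt n A M φ ∈ spinZSector (Λ := Λ) n M := by
  classical
  rw [mem_spinZSector_iff]
  intro σ hσ
  simp [marshallExt, hσ]

omit [DecidableEq Λ] in
/-- `marshallRes (marshallExt φ) = φ`. [folklore] -/
theorem marshallRes_marshallExt (φ : {σ : TensorIndex Λ (n + 1) // mag n σ = M} → ℂ) :
    marshallRes n A M (marshallExt n A M φ) = φ := by
  funext s
  simp only [marshallRes, marshallExt, dif_pos s.2, ← mul_assoc, marshallSign_mul_self, one_mul]

/-- `marshallExt (marshallRes v) = v` for `v` in the sector. [folklore] -/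
theorem marshallExt_marshallRes {v : TensorIndex Λ (n + 1) → ℂ} (hv : v ∈ spinZSector (Λ := Λ) n M) :
    marshallExt n A M (marshallRes n A M v) = v := by
  classical
  rw [mem_spinZSector_iff] at hv
  funext σ
  by_cases h : mag n σ = M
  · simp only [marshallExt, marshallRes, dif_pos h, ← mul_assoc, marshallSign_mul_self, one_mul]
  · simp only [marshallExt, dif_neg h, hv σ h]

omit [DecidableEq Λ] in
/-- `marshallRes` is linear in the vector (scalars). [folklore] -/
theorem marshallRes_smul (c : ℂ) (v : TensorIndex Λ (n + 1) → ℂ) :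
    marshallRes n A M (c • v) = c • marshallRes n A M v := by
  funext s; simp only [marshallRes, Pi.smul_apply, smul_eq_mul]; ring

/-- `marshallRes` is injective on the sector. [folklore] -/
theorem marshallRes_injOn {v w : TensorIndex Λ (n + 1) → ℂ} (hv : v ∈ spinZSector (Λ := Λ) n M)
    (hw : w ∈ spinZSector (Λ := Λ) n M) (h : marshallRes n A M v = marshallRes n A M w) : v = w := by
  rw [← marshallExt_marshallRes (A := A) hv, ← marshallExt_marshallRes (A := A) hw, h]

/-- Inner products are preserved: `⟨marshallRes v, marshallRes w⟩ = ⟨v, w⟩` for `w` in the sector.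
[folklore] -/
theorem marshallRes_dotProduct {w : TensorIndex Λ (n + 1) → ℂ} (v : TensorIndex Λ (n + 1) → ℂ)
    (hw : w ∈ spinZSector (Λ := Λ) n M) :
    star (marshallRes n A M v) ⬝ᵥ marshallRes n A M w = star v ⬝ᵥ w := by
  rw [mem_spinZSector_iff] at hw
  rw [dotProduct, dotProduct, sum_eq_sum_sector (fun σ => star v σ * w σ)
    (fun σ hσ => by rw [hw σ hσ, mul_zero])]
  refine Finset.sum_congr rfl fun s _ => ?_
  simp only [marshallRes, Pi.star_apply, star_mul', star_marshallSign]
  calc marshallSign A s.1 * star (v s.1) * (marshallSign A s.1 * w s.1)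
      = star (v s.1) * w s.1 * (marshallSign A s.1 * marshallSign A s.1) := by ring
    _ = star (v s.1) * w s.1 := by rw [marshallSign_mul_self, mul_one]

/-- **The twisted block represents `H` on the sector**: for `v ∈ 𝓗_M`,
`marshallRes (H v) = marshallBlock H · marshallRes v`. [folklore] -/
theorem marshallRes_heisenberg_mulVec {v : TensorIndex Λ (n + 1) → ℂ} (hv : v ∈ spinZSector (Λ := Λ) n M) :
    marshallRes n A M (heisenbergHamiltonian n G J *ᵥ v) =
      marshallBlock n A M (heisenbergHamiltonian n G J) *ᵥ marshallRes n A M v := by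
  have hv' := (mem_spinZSector_iff n M v).1 hv
  funext s
  simp only [marshallRes, marshallBlock, mulVec, dotProduct, Matrix.of_apply]
  rw [sum_eq_sum_sector (fun τ => heisenbergHamiltonian n G J s.1 τ * v τ)
    (fun τ hτ => by rw [hv' τ hτ, mul_zero]), Finset.mul_sum]
  refine Finset.sum_congr rfl fun t _ => ?_
  calc marshallSign A s.1 * (heisenbergHamiltonian n G J s.1 t.1 * v t.1)
      = marshallSign A s.1 * heisenbergHamiltonian n G J s.1 t.1 *
          (marshallSign A t.1 * marshallSign A t.1) * v t.1 := by rw [marshallSign_mul_self]; ring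
    _ = marshallSign A s.1 * heisenbergHamiltonian n G J s.1 t.1 * marshallSign A t.1 *
          (marshallSign A t.1 * v t.1) := by ring

variable (n A M) in
/-- The twisted block is symmetric. [folklore] -/
theorem marshallBlock_symm (s t : {σ : TensorIndex Λ (n + 1) // mag n σ = M}) :
    marshallBlock n A M (heisenbergHamiltonian n G J) s t =
      marshallBlock n A M (heisenbergHamiltonian n G J) t s := by
  change marshallSign A s.1 * heisenbergHamiltonian n G J s.1 t.1 * marshallSign A t.1 =
    marshallSign A t.1 * heisenbergHamiltonian n G J t.1 s.1 * marshallSign A s.1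
  rw [LiebMattis.heisenbergHamiltonian_apply_comm n G J s.1 t.1]; ring

variable (n A M) in
/-- The twisted block has real entries. [folklore] -/
theorem star_marshallBlock (s t : {σ : TensorIndex Λ (n + 1) // mag n σ = M}) :
    star (marshallBlock n A M (heisenbergHamiltonian n G J) s t) =
      marshallBlock n A M (heisenbergHamiltonian n G J) s t := by
  simp only [marshallBlock, Matrix.of_apply, star_mul', star_marshallSign, LiebMattis.star_heisenbergHamiltonian_apply]

/-- **Marshall: the twisted block has nonpositive off-diagonal entries** (bipartite graph,
`J ≥ 0`). Marshall (1955); Lieb–Mattis (1962), proof of Thm 2; Mattis (2006) §5.10. [cite: Marshall1955] -/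
theorem marshallBlock_re_nonpos (hA : G.IsBipartiteWith (A : Set Λ) (↑A)ᶜ) (hJ : 0 ≤ J)
    {s t : {σ : TensorIndex Λ (n + 1) // mag n σ = M}} (hst : s ≠ t) :
    (marshallBlock n A M (heisenbergHamiltonian n G J) s t).re ≤ 0 := by
  have hst' : s.1 ≠ t.1 := fun h => hst (Subtype.ext h)
  simp only [marshallBlock, Matrix.of_apply]
  by_cases h0 : heisenbergHamiltonian n G J s.1 t.1 = 0
  · rw [h0]; simp
  · rw [marshallSign_eq_neg_of_apply_ne_zero n J hA hst' h0]
    have : marshallSign A s.1 * heisenbergHamiltonian n G J s.1 t.1 * -marshallSign A s.1 =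
        -heisenbergHamiltonian n G J s.1 t.1 := by
      calc _ = -(marshallSign A s.1 * marshallSign A s.1) * heisenbergHamiltonian n G J s.1 t.1 := by ring
        _ = _ := by rw [marshallSign_mul_self]; ring
    rw [this, Complex.neg_re, neg_nonpos]
    exact heisenberg_apply_re_nonneg n G J hJ hst'

/-- **The hop graph of the twisted block is connected** in every sector (`G` connected, `J > 0`).
Lieb–Mattis (1962), proof of Thm 2. [folklore] -/
theorem marshallBlock_connected (hG : G.Connected) (hJ : 0 < J)
    (s t : {σ : TensorIndex Λ (n + 1) // mag n σ = M}) :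
    Relation.ReflTransGen (fun a b : {σ : TensorIndex Λ (n + 1) // mag n σ = M} =>
      marshallBlock n A M (heisenbergHamiltonian n G J) a b ≠ 0) s t := by
  have hsum : ∑ z, (s.1 z).val = ∑ z, (t.1 z).val := (mag_eq_mag_iff s.1 t.1).1 (s.2.trans t.2.symm)
  have h := reflTransGen_isSpinHop G hG s.1 t.1 hsum
  obtain ⟨ht, h'⟩ := reflTransGen_subtype (p := fun σ => mag n σ = M)
    (fun a b (hab : IsSpinHop G a b) ha => (hab.mag_eq (G := G)).symm.trans ha) h s.2
  have h'' : Relation.ReflTransGen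
      (fun a b : {σ : TensorIndex Λ (n + 1) // mag n σ = M} => IsSpinHop G a.1 b.1) s t := h'
  refine Relation.ReflTransGen.mono (fun a b hab => ?_) s t h''
  obtain ⟨x, y, hxy, hoff, h1, h2⟩ := hab
  have hpos := heisenberg_apply_re_pos_of_hop n G J hJ hxy hoff h1 h2
  simp only [marshallBlock, Matrix.of_apply]
  refine mul_ne_zero (mul_ne_zero (marshallSign_ne_zero A _) ?_) (marshallSign_ne_zero A _)
  intro h; rw [h] at hpos; simp at hpos

/-- From the bound on unit vectors of the sector to the homogeneous bound `E ‖v‖² ≤ Re ⟨v, H v⟩`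
(normalise `v ≠ 0`). Tasaki (2020) §2.1. [folklore] -/
theorem mul_norm_le_of_unit_bound' {H : Op Λ (n + 1)} {E : ℝ}
    (hb : ∀ v ∈ spinZSector (Λ := Λ) n M, star v ⬝ᵥ v = 1 → E ≤ (star v ⬝ᵥ H *ᵥ v).re)
    {v : TensorIndex Λ (n + 1) → ℂ} (hv : v ∈ spinZSector (Λ := Λ) n M) :
    E * (star v ⬝ᵥ v).re ≤ (star v ⬝ᵥ H *ᵥ v).re := by
  by_cases h0 : v = 0
  · subst h0; simp
  obtain ⟨c, hc0, hc1⟩ := exists_smul_unit h0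
  have h2 := hb _ (Submodule.smul_mem _ c hv) hc1
  have hcc : star c * c = ((‖c‖ ^ 2 : ℝ) : ℂ) := by
    rw [Complex.star_def, Complex.conj_mul']; push_cast; rfl
  rw [mulVec_smul, star_smul, smul_dotProduct, dotProduct_smul, smul_smul, hcc, smul_eq_mul,
    Complex.re_ofReal_mul] at h2
  rw [star_smul, smul_dotProduct, dotProduct_smul, smul_smul, hcc, smul_eq_mul] at hc1
  have h1 : ‖c‖ ^ 2 * (star v ⬝ᵥ v).re = 1 := by
    have := congrArg Complex.re hc1
    rwa [Complex.re_ofReal_mul, Complex.one_re] at this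
  have hpos : 0 < ‖c‖ ^ 2 := by positivity
  have key : ‖c‖ ^ 2 * (E * (star v ⬝ᵥ v).re) ≤ ‖c‖ ^ 2 * (star v ⬝ᵥ H *ᵥ v).re :=
    calc ‖c‖ ^ 2 * (E * (star v ⬝ᵥ v).re) = E * (‖c‖ ^ 2 * (star v ⬝ᵥ v).re) := by ring
      _ = E := by rw [h1, mul_one]
      _ ≤ ‖c‖ ^ 2 * (star v ⬝ᵥ H *ᵥ v).re := h2
  exact le_of_mul_le_mul_left key hpos

/-- **Ground states exist in every allowed sector** and the sector energy
`E(M) = lowestEnergyInSector` bounds `H` from below on `𝓗_M` (`sector_groundState` for the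
coordinate subspace `𝓗_M`; no bipartiteness needed). Tasaki (2020) §2.2, §2.4. [folklore] -/
theorem liebMattis_sector_groundState (hM : spinZSector (Λ := Λ) n M ≠ ⊥) :
    (∃ v ∈ spinZSector (Λ := Λ) n M, v ≠ 0 ∧
      heisenbergHamiltonian n G J *ᵥ v =
        ((lowestEnergyInSector n (heisenbergHamiltonian n G J) M : ℝ) : ℂ) • v) ∧
    ∀ v ∈ spinZSector (Λ := Λ) n M,
      lowestEnergyInSector n (heisenbergHamiltonian n G J) M * (star v ⬝ᵥ v).re ≤
        (star v ⬝ᵥ heisenbergHamiltonian n G J *ᵥ v).re := by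
  classical
  have hp : ∃ σ : TensorIndex Λ (n + 1), mag n σ = M := (spinZSector_ne_bot_iff n M).1 hM
  have hinv : ∀ σ τ : TensorIndex Λ (n + 1), ¬ mag n σ = M → mag n τ = M →
      heisenbergHamiltonian n G J σ τ = 0 := fun σ τ hσ hτ =>
    heisenberg_apply_eq_zero_of_mag_ne n G J (by rw [hτ]; exact hσ)
  obtain ⟨h1, h2⟩ := sector_groundState (heisenbergHamiltonian n G J)
    (heisenbergHamiltonian_isHermitian n G J) (fun σ => mag n σ = M) hp hinv (spinZSector n M)
    (mem_spinZSector_iff n M)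
  exact ⟨h1, fun v hv => mul_norm_le_of_unit_bound' h2 hv⟩

/-- The energy bound transported to the twisted block. [folklore] -/
theorem marshallBlock_energy_le (hM : spinZSector (Λ := Λ) n M ≠ ⊥)
    (φ : {σ : TensorIndex Λ (n + 1) // mag n σ = M} → ℂ) :
    lowestEnergyInSector n (heisenbergHamiltonian n G J) M * (star φ ⬝ᵥ φ).re ≤
      (star φ ⬝ᵥ marshallBlock n A M (heisenbergHamiltonian n G J) *ᵥ φ).re := by
  have hv := marshallExt_mem (A := A) φ
  have h := (liebMattis_sector_groundState G J hM).2 _ hv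
  rw [← marshallRes_marshallExt (A := A) φ, ← marshallRes_heisenberg_mulVec G J hv,
    marshallRes_dotProduct _ hv, marshallRes_dotProduct _ (heisenberg_mulVec_mem_spinZSector n G J hv)]
  exact h

/-- **Lieb–Mattis / Marshall: uniqueness of the ground state in each sector.** For the spin-`n/2`
Heisenberg antiferromagnet (`J > 0`) on a connected bipartite graph, in every allowed sector
`S^z_tot = M` any two eigenvectors of `H` in `𝓗_M` with the sector energy `E(M)` are proportional
(Perron–Frobenius for the Marshall-twisted block). Lieb–Mattis (1962), Thm 2 (proof);
Marshall (1955); Tasaki (2020) Thm 2.3; Mattis (2006) §5.10. [cite: LiebMattis1962, Theorem 2] -/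
theorem liebMattis_sector_unique (hG : G.Connected) (hA : G.IsBipartiteWith (A : Set Λ) (↑A)ᶜ)
    (hJ : 0 < J) (hM : spinZSector (Λ := Λ) n M ≠ ⊥) {v w : TensorIndex Λ (n + 1) → ℂ}
    (hv : v ∈ spinZSector (Λ := Λ) n M) (hw : w ∈ spinZSector (Λ := Λ) n M) (hv0 : v ≠ 0)
    (hHv : heisenbergHamiltonian n G J *ᵥ v =
      ((lowestEnergyInSector n (heisenbergHamiltonian n G J) M : ℝ) : ℂ) • v)
    (hHw : heisenbergHamiltonian n G J *ᵥ w =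
      ((lowestEnergyInSector n (heisenbergHamiltonian n G J) M : ℝ) : ℂ) • w) :
    ∃ c : ℂ, w = c • v := by
  have hv' : marshallBlock n A M (heisenbergHamiltonian n G J) *ᵥ marshallRes n A M v =
      ((lowestEnergyInSector n (heisenbergHamiltonian n G J) M : ℝ) : ℂ) • marshallRes n A M v := by
    rw [← marshallRes_heisenberg_mulVec G J hv, hHv, marshallRes_smul]
  have hw' : marshallBlock n A M (heisenbergHamiltonian n G J) *ᵥ marshallRes n A M w =
      ((lowestEnergyInSector n (heisenbergHamiltonian n G J) M : ℝ) : ℂ) • marshallRes n A M w := by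
    rw [← marshallRes_heisenberg_mulVec G J hw, hHw, marshallRes_smul]
  have hv0' : marshallRes n A M v ≠ 0 := by
    intro h
    apply hv0
    have : marshallRes n A M v = marshallRes n A M 0 := by
      rw [h]; funext s; simp [marshallRes]
    exact marshallRes_injOn hv (Submodule.zero_mem _) this
  obtain ⟨c, hc⟩ := perronFrobenius_groundState_unique (marshallBlock_symm n G A J M)
    (star_marshallBlock n G A J M) (fun s t hst => marshallBlock_re_nonpos G J hA hJ.le hst)
    (marshallBlock_connected G J hG hJ) (marshallBlock_energy_le G J hM) hv' hw' hv0'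
  refine ⟨c, marshallRes_injOn (A := A) hw (Submodule.smul_mem _ c hv) ?_⟩
  rw [hc, marshallRes_smul]

/-- **Lieb–Mattis / Marshall: positivity of the sector ground state.** Under the same hypotheses,
a sector ground state `v` has, after multiplication by one nonzero constant, all its amplitudes
`marshallSign(σ) v(σ)` real and strictly positive on the sector (Marshall's sign rule; the
Perron–Frobenius vector of the twisted block). Marshall (1955); Lieb–Mattis (1962), proof of
Thm 2; Tasaki (2020) Thm 2.3; Mattis (2006) §5.10 ("nodeless"). [cite: LiebMattis1962, Theorem 2] -/
theorem liebMattis_sector_pos (hG : G.Connected) (hA : G.IsBipartiteWith (A : Set Λ) (↑A)ᶜ)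
    (hJ : 0 < J) (hM : spinZSector (Λ := Λ) n M ≠ ⊥) {v : TensorIndex Λ (n + 1) → ℂ}
    (hv : v ∈ spinZSector (Λ := Λ) n M) (hv0 : v ≠ 0)
    (hHv : heisenbergHamiltonian n G J *ᵥ v =
      ((lowestEnergyInSector n (heisenbergHamiltonian n G J) M : ℝ) : ℂ) • v) :
    ∃ c : ℂ, c ≠ 0 ∧ ∀ σ : TensorIndex Λ (n + 1), mag n σ = M →
      0 < (c * (marshallSign A σ * v σ)).re ∧ (c * (marshallSign A σ * v σ)).im = 0 := by
  have hv' : marshallBlock n A M (heisenbergHamiltonian n G J) *ᵥ marshallRes n A M v =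
      ((lowestEnergyInSector n (heisenbergHamiltonian n G J) M : ℝ) : ℂ) • marshallRes n A M v := by
    rw [← marshallRes_heisenberg_mulVec G J hv, hHv, marshallRes_smul]
  have hv0' : marshallRes n A M v ≠ 0 := by
    intro h
    apply hv0
    have : marshallRes n A M v = marshallRes n A M 0 := by
      rw [h]; funext s; simp [marshallRes]
    exact marshallRes_injOn hv (Submodule.zero_mem _) this
  obtain ⟨c, hc0, hc⟩ := perronFrobenius_groundState_smul_pos (marshallBlock_symm n G A J M)
    (star_marshallBlock n G A J M) (fun s t hst => marshallBlock_re_nonpos G J hA hJ.le hst)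
    (marshallBlock_connected G J hG hJ) (marshallBlock_energy_le G J hM) hv' hv0'
  exact ⟨c, hc0, fun σ hσ => hc ⟨σ, hσ⟩⟩

end Perron

/-! ## III. The `su(2)` ladder algebra of (partial) total spins -/

section Ladder

variable {Λ : Type*} [Fintype Λ] [DecidableEq Λ] (n : ℕ)

/-- The raising operator `S⁺_X = Σ_{x ∈ X} S⁺_x` of a set of sites. Tasaki (2020) §2.2,
eq. (2.2.11); §2.4, eq. (2.4.6). [folklore] -/
def raiseOn (X : Finset Λ) : Op Λ (n + 1) := ∑ x ∈ X, onSite x (spinRaise n)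

/-- The lowering operator `S⁻_X = Σ_{x ∈ X} S⁻_x` of a set of sites. Tasaki (2020) §2.2,
eq. (2.2.11); §2.4, eq. (2.4.6). [folklore] -/
def lowerOn (X : Finset Λ) : Op Λ (n + 1) := ∑ x ∈ X, onSite x (spinLower n)

/-- The `z`-component `S^z_X = Σ_{x ∈ X} S^z_x` of the spin of a set of sites. Tasaki (2020) §2.2,
eq. (2.2.11). [folklore] -/
def zOn (X : Finset Λ) : Op Λ (n + 1) := ∑ x ∈ X, onSite x (SpinOperators.spinZ n)

/-- `S^z_Λ = S^z_tot`. [folklore] -/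
theorem zOn_univ : zOn n (Finset.univ : Finset Λ) = totalSpin n 2 := by
  simp only [zOn, totalSpin, siteSpin, spinVec_two]

/-- **Commutator of two sums of single-site operators over the same set**:
`[Σ_{x∈X} a_x, Σ_{y∈X} b_y] = Σ_{x∈X} [a, b]_x` (operators at distinct sites commute).
Tasaki (2020) §2.2, eq. (2.2.6). [folklore] -/
theorem sum_onSite_mul_sum_onSite_sub {q : ℕ} (X : Finset Λ) (a b : Matrix (Fin q) (Fin q) ℂ) :
    (∑ x ∈ X, (onSite x a : Op Λ q)) * (∑ y ∈ X, onSite y b) -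
        (∑ y ∈ X, (onSite y b : Op Λ q)) * (∑ x ∈ X, onSite x a) =
      ∑ x ∈ X, onSite x (a * b - b * a) := by
  rw [Finset.sum_mul_sum, Finset.sum_mul_sum, Finset.sum_comm (s := X) (t := X)
    (f := fun y x => (onSite y b : Op Λ q) * onSite x a), ← Finset.sum_sub_distrib]
  refine Finset.sum_congr rfl fun x hx => ?_
  rw [← Finset.sum_sub_distrib, Finset.sum_eq_single x]
  · rw [onSite_mul, onSite_mul, onSite_sub']
  · intro y _ hyx
    rw [onSite_mul_onSite_comm (Ne.symm hyx), sub_self]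
  · intro h; exact absurd hx h

/-- `(S⁺_X)ᴴ = S⁻_X`. [folklore] -/
theorem lowerOn_eq_conjTranspose (X : Finset Λ) : lowerOn n X = (raiseOn n X)ᴴ := by
  rw [raiseOn, lowerOn, conjTranspose_sum]
  exact Finset.sum_congr rfl fun x _ => by rw [spinLower, onSite_conjTranspose]

/-- `S^z_X` is Hermitian. [folklore] -/
theorem zOn_conjTranspose (X : Finset Λ) : (zOn n X)ᴴ = zOn n X := by
  rw [zOn, conjTranspose_sum]
  exact Finset.sum_congr rfl fun x _ => by
    rw [← onSite_conjTranspose, ← spinVec_two, (spinVec_isHermitian n 2).eq]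

/-- **The partial total spins satisfy the `su(2)` relations**: `S⁻_X = (S⁺_X)†`,
`[S⁺_X, S⁻_X] = 2 S^z_X`, `[S^z_X, S^±_X] = ± S^±_X`. Tasaki (2020) §2.4, eqs. (2.4.5)–(2.4.7);
§2.2. [folklore] -/
theorem isSu2Triple_on (X : Finset Λ) : IsSu2Triple (raiseOn n X) (lowerOn n X) (zOn n X) := by
  refine IsSu2Triple.mk' (lowerOn_eq_conjTranspose n X) (zOn_conjTranspose n X) ?_ ?_
  · rw [raiseOn, lowerOn, zOn, sum_onSite_mul_sum_onSite_sub, spinRaise_commutator_spinLower,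
      Finset.smul_sum]
    exact Finset.sum_congr rfl fun x _ => by rw [onSite_smul']
  · rw [zOn, raiseOn, sum_onSite_mul_sum_onSite_sub, spinZ_commutator_spinRaise]

/-- `S⁺ = Sˣ + i Sʸ` for one spin. Tasaki (2020) §2.1, eq. (2.1.6). [folklore] -/
theorem spinRaise_eq_spinX_add_I_smul_spinY : spinRaise n = spinX n + I • spinY n := by
  rw [spinX, spinY, smul_smul]
  have h : I * (1 / (2 * I)) = 1 / 2 := by field_simp
  rw [h, ← smul_add]
  rw [show spinRaise n + spinLower n + (spinRaise n - spinLower n) = (2 : ℂ) • spinRaise n by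
    rw [two_smul]; abel, smul_smul]
  norm_num

/-- `S⁻ = Sˣ - i Sʸ` for one spin. Tasaki (2020) §2.1, eq. (2.1.6). [folklore] -/
theorem spinLower_eq_spinX_sub_I_smul_spinY : spinLower n = spinX n - I • spinY n := by
  rw [spinX, spinY, smul_smul]
  have h : I * (1 / (2 * I)) = 1 / 2 := by field_simp
  rw [h, ← smul_sub]
  rw [show spinRaise n + spinLower n - (spinRaise n - spinLower n) = (2 : ℂ) • spinLower n by
    rw [two_smul]; abel, smul_smul]
  norm_num

/-- `S⁺_tot = Sˣ_tot + i Sʸ_tot`. Tasaki (2020) §2.4, eq. (2.4.6). [folklore] -/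
theorem raiseOn_univ : raiseOn n (Finset.univ : Finset Λ) = totalSpin n 0 + I • totalSpin n 1 := by
  simp only [raiseOn, totalSpin, siteSpin, spinVec_zero, spinVec_one, Finset.smul_sum,
    ← Finset.sum_add_distrib, ← onSite_smul', ← onSite_add', ← spinRaise_eq_spinX_add_I_smul_spinY]

/-- `S⁻_tot = Sˣ_tot - i Sʸ_tot`. Tasaki (2020) §2.4, eq. (2.4.6). [folklore] -/
theorem lowerOn_univ : lowerOn n (Finset.univ : Finset Λ) = totalSpin n 0 - I • totalSpin n 1 := by
  simp only [lowerOn, totalSpin, siteSpin, spinVec_zero, spinVec_one, Finset.smul_sum,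
    ← Finset.sum_sub_distrib, ← onSite_smul', ← onSite_sub', ← spinLower_eq_spinX_sub_I_smul_spinY]

/-- **`(𝐒_tot)²` is the `su(2)` Casimir of `(S⁺_tot, S⁻_tot, S^z_tot)`**:
`Σ_α (S^α_tot)² = (S^z)² + ½(S⁺S⁻ + S⁻S⁺)`. Tasaki (2020) §2.4, eq. (2.4.7); App. A.3. [folklore] -/
theorem totalSpinSq_eq_su2Casimir :
    (totalSpinSq n : Op Λ (n + 1)) =
      su2Casimir (raiseOn n Finset.univ) (lowerOn n Finset.univ) (zOn n Finset.univ) := by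
  rw [su2Casimir, raiseOn_univ, lowerOn_univ, zOn_univ, totalSpinSq, Fin.sum_univ_three]
  set X : Op Λ (n + 1) := totalSpin n 0
  set Y : Op Λ (n + 1) := totalSpin n 1
  set Z : Op Λ (n + 1) := totalSpin n 2
  have h : (X + I • Y) * (X - I • Y) + (X - I • Y) * (X + I • Y) =
      (X * X + Y * Y) + (X * X + Y * Y) := by
    simp only [mul_sub, mul_add, sub_mul, add_mul, smul_mul_assoc, mul_smul_comm, smul_smul,
      I_mul_I, smul_add, smul_sub, neg_smul, one_smul]
    abel
  rw [h, ← two_smul ℂ (X * X + Y * Y), smul_smul]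
  norm_num
  abel

section Graph

variable (G : SimpleGraph Λ) [DecidableRel G.Adj] (J : ℝ)

/-- `[H, S⁺_tot] = 0`. Tasaki (2020) §2.5, eq. (2.5.2). [folklore] -/
theorem commute_heisenberg_raiseOn :
    Commute (heisenbergHamiltonian n G J) (raiseOn n Finset.univ) := by
  rw [raiseOn_univ]
  exact (commute_heisenbergHamiltonian_totalSpin n G J 0).add_right
    ((commute_heisenbergHamiltonian_totalSpin n G J 1).smul_right _)

/-- `[H, S⁻_tot] = 0`. Tasaki (2020) §2.5, eq. (2.5.2). [folklore] -/
theorem commute_heisenberg_lowerOn :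
    Commute (heisenbergHamiltonian n G J) (lowerOn n Finset.univ) := by
  rw [lowerOn_univ]
  exact (commute_heisenbergHamiltonian_totalSpin n G J 0).sub_right
    ((commute_heisenbergHamiltonian_totalSpin n G J 1).smul_right _)

/-- `[H, S^z_tot] = 0`. Tasaki (2020) §2.5, eq. (2.5.2). [folklore] -/
theorem commute_heisenberg_zOn : Commute (heisenbergHamiltonian n G J) (zOn n Finset.univ) := by
  rw [zOn_univ]; exact commute_heisenbergHamiltonian_totalSpin n G J 2

end Graph

/-- `[(𝐒_tot)², S^z_tot] = 0`. Tasaki (2020) §2.4. [folklore] -/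
theorem commute_totalSpinSq_zOn : Commute (totalSpinSq n : Op Λ (n + 1)) (zOn n Finset.univ) := by
  rw [totalSpinSq_eq_su2Casimir]; exact (isSu2Triple_on n Finset.univ).su2Casimir_mul_Z

/-- `[(𝐒_tot)², S⁻_tot] = 0`. Tasaki (2020) §2.4. [folklore] -/
theorem commute_totalSpinSq_lowerOn : Commute (totalSpinSq n : Op Λ (n + 1)) (lowerOn n Finset.univ) := by
  rw [totalSpinSq_eq_su2Casimir]; exact (isSu2Triple_on n Finset.univ).su2Casimir_mul_M

/-- `[(𝐒_tot)², S⁺_tot] = 0`. Tasaki (2020) §2.4. [folklore] -/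
theorem commute_totalSpinSq_raiseOn : Commute (totalSpinSq n : Op Λ (n + 1)) (raiseOn n Finset.univ) := by
  rw [totalSpinSq_eq_su2Casimir]; exact (isSu2Triple_on n Finset.univ).su2Casimir_mul_P

/-! ### Sectors as weight spaces; ladder operators move between sectors -/

/-- `v ∈ 𝓗_M` iff `S^z_tot v = M v`. [folklore] -/
theorem mem_spinZSector_iff_mulVec (M : ℝ) (v : TensorIndex Λ (n + 1) → ℂ) :
    v ∈ spinZSector (Λ := Λ) n M ↔ zOn n Finset.univ *ᵥ v = (M : ℂ) • v := by
  rw [spinZSector, Module.End.mem_eigenspace_iff, Matrix.toLin'_apply, zOn_univ]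

/-- `S⁻_tot` maps `𝓗_M` to `𝓗_{M-1}`. Tasaki (2020) §2.4. [folklore] -/
theorem lowerOn_mulVec_mem {M : ℝ} {v : TensorIndex Λ (n + 1) → ℂ} (hv : v ∈ spinZSector (Λ := Λ) n M) :
    lowerOn n Finset.univ *ᵥ v ∈ spinZSector (Λ := Λ) n (M - 1) := by
  rw [mem_spinZSector_iff_mulVec] at hv ⊢
  rw [(isSu2Triple_on n Finset.univ).weight_M hv]; push_cast; rfl

/-- `S⁺_tot` maps `𝓗_M` to `𝓗_{M+1}`. Tasaki (2020) §2.4. [folklore] -/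
theorem raiseOn_mulVec_mem {M : ℝ} {v : TensorIndex Λ (n + 1) → ℂ} (hv : v ∈ spinZSector (Λ := Λ) n M) :
    raiseOn n Finset.univ *ᵥ v ∈ spinZSector (Λ := Λ) n (M + 1) := by
  rw [mem_spinZSector_iff_mulVec] at hv ⊢
  rw [(isSu2Triple_on n Finset.univ).weight_P hv]; push_cast; rfl

/-- `(𝐒_tot)²` preserves every sector. [folklore] -/
theorem totalSpinSq_mulVec_mem {M : ℝ} {v : TensorIndex Λ (n + 1) → ℂ} (hv : v ∈ spinZSector (Λ := Λ) n M) :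
    totalSpinSq n *ᵥ v ∈ spinZSector (Λ := Λ) n M := by
  rw [mem_spinZSector_iff_mulVec] at hv ⊢
  rw [mulVec_mulVec, ← (commute_totalSpinSq_zOn n).eq, ← mulVec_mulVec, hv, mulVec_smul]

/-! ### Norm identities: when `S^±_tot v ≠ 0` -/

/-- **`‖S⁻v‖² = (S(S+1) - M(M-1)) ‖v‖²`** for `(𝐒_tot)² v = S(S+1) v`, `S^z_tot v = M v`.
Tasaki (2020) §2.4, Appendix A.3. [folklore] -/
theorem norm_lowerOn_mulVec {v : TensorIndex Λ (n + 1) → ℂ} {S M : ℝ}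
    (hS : totalSpinSq n *ᵥ v = ((S * (S + 1) : ℝ) : ℂ) • v) (hM : v ∈ spinZSector (Λ := Λ) n M) :
    star (lowerOn n Finset.univ *ᵥ v) ⬝ᵥ (lowerOn n Finset.univ *ᵥ v) =
      ((S * (S + 1) - M * (M - 1) : ℝ) : ℂ) * (star v ⬝ᵥ v) := by
  have h := isSu2Triple_on n (Finset.univ : Finset Λ)
  rw [mem_spinZSector_iff_mulVec] at hM
  rw [totalSpinSq_eq_su2Casimir] at hS
  have hPM : raiseOn n (Finset.univ : Finset Λ) * lowerOn n Finset.univ =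
      su2Casimir (raiseOn n Finset.univ) (lowerOn n Finset.univ) (zOn n Finset.univ) -
        zOn n Finset.univ * zOn n Finset.univ + zOn n Finset.univ := by
    rw [h.su2Casimir_eq']; abel
  rw [h.star_M_mulVec_dotProduct, mulVec_mulVec, hPM, add_mulVec, sub_mulVec, hS,
    ← mulVec_mulVec, hM, mulVec_smul, hM, smul_smul, dotProduct_add, dotProduct_sub,
    dotProduct_smul, dotProduct_smul, dotProduct_smul, smul_eq_mul, smul_eq_mul, smul_eq_mul]
  push_cast; ring

/-- **`‖S⁺v‖² = (S(S+1) - M(M+1)) ‖v‖²`** for `(𝐒_tot)² v = S(S+1) v`, `S^z_tot v = M v`.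
Tasaki (2020) §2.4, Appendix A.3. [folklore] -/
theorem norm_raiseOn_mulVec {v : TensorIndex Λ (n + 1) → ℂ} {S M : ℝ}
    (hS : totalSpinSq n *ᵥ v = ((S * (S + 1) : ℝ) : ℂ) • v) (hM : v ∈ spinZSector (Λ := Λ) n M) :
    star (raiseOn n Finset.univ *ᵥ v) ⬝ᵥ (raiseOn n Finset.univ *ᵥ v) =
      ((S * (S + 1) - M * (M + 1) : ℝ) : ℂ) * (star v ⬝ᵥ v) := by
  have h := isSu2Triple_on n (Finset.univ : Finset Λ)
  rw [mem_spinZSector_iff_mulVec] at hM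
  rw [totalSpinSq_eq_su2Casimir] at hS
  have hMP : lowerOn n (Finset.univ : Finset Λ) * raiseOn n Finset.univ =
      su2Casimir (raiseOn n Finset.univ) (lowerOn n Finset.univ) (zOn n Finset.univ) -
        zOn n Finset.univ * zOn n Finset.univ - zOn n Finset.univ := by
    rw [h.su2Casimir_eq]; abel
  rw [h.star_P_mulVec_dotProduct, mulVec_mulVec, hMP, sub_mulVec, sub_mulVec, hS,
    ← mulVec_mulVec, hM, mulVec_smul, hM, smul_smul, dotProduct_sub, dotProduct_sub,
    dotProduct_smul, dotProduct_smul, dotProduct_smul, smul_eq_mul, smul_eq_mul, smul_eq_mul]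
  push_cast; ring

/-- `S⁻_tot v ≠ 0` for a nonzero vector of total spin `S` and weight `M` with `-S < M ≤ S`... precisely
whenever `S(S+1) - M(M-1) ≠ 0` fails to vanish, here under `0 ≤ S`, `-S < M`, `M ≤ S`.
Tasaki (2020) §2.4. [folklore] -/
theorem lowerOn_mulVec_ne_zero {v : TensorIndex Λ (n + 1) → ℂ} {S M : ℝ}
    (hS : totalSpinSq n *ᵥ v = ((S * (S + 1) : ℝ) : ℂ) • v) (hM : v ∈ spinZSector (Λ := Λ) n M)
    (hv : v ≠ 0) (h1 : -S < M) (h2 : M ≤ S) : lowerOn n Finset.univ *ᵥ v ≠ 0 := by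
  intro h0
  have key := norm_lowerOn_mulVec n hS hM
  rw [h0, dotProduct_zero] at key
  have hpos : 0 < star v ⬝ᵥ v := dotProduct_star_self_pos_iff.2 hv
  have hc : (0 : ℝ) < S * (S + 1) - M * (M - 1) := by nlinarith
  have : (0 : ℂ) < ((S * (S + 1) - M * (M - 1) : ℝ) : ℂ) * (star v ⬝ᵥ v) :=
    mul_pos (by exact_mod_cast hc) hpos
  rw [← key] at this
  exact lt_irrefl _ this

/-- `S⁺_tot v ≠ 0` for a nonzero vector of total spin `S ≥ 0` and weight `M` with `-S ≤ M < S`.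
Tasaki (2020) §2.4. [folklore] -/
theorem raiseOn_mulVec_ne_zero {v : TensorIndex Λ (n + 1) → ℂ} {S M : ℝ}
    (hS : totalSpinSq n *ᵥ v = ((S * (S + 1) : ℝ) : ℂ) • v) (hM : v ∈ spinZSector (Λ := Λ) n M)
    (hv : v ≠ 0) (h1 : -S ≤ M) (h2 : M < S) : raiseOn n Finset.univ *ᵥ v ≠ 0 := by
  intro h0
  have key := norm_raiseOn_mulVec n hS hM
  rw [h0, dotProduct_zero] at key
  have hpos : 0 < star v ⬝ᵥ v := dotProduct_star_self_pos_iff.2 hv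
  have hc : (0 : ℝ) < S * (S + 1) - M * (M + 1) := by nlinarith
  have : (0 : ℂ) < ((S * (S + 1) - M * (M + 1) : ℝ) : ℂ) * (star v ⬝ᵥ v) :=
    mul_pos (by exact_mod_cast hc) hpos
  rw [← key] at this
  exact lt_irrefl _ this

/-- Iterated lowering of a vector of total spin `S ≥ 0` and weight `M ≤ S`: `(S⁻_tot)^k v` lies in
`𝓗_{M-k}`, has total spin `S`, and is nonzero as long as `M - k > -S - 1`, i.e. `k < M + S + 1`.
Tasaki (2020) §2.4, App. A.3. [folklore] -/
theorem lowerOn_pow_mulVec {v : TensorIndex Λ (n + 1) → ℂ} {S M : ℝ}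
    (hS : totalSpinSq n *ᵥ v = ((S * (S + 1) : ℝ) : ℂ) • v) (hM : v ∈ spinZSector (Λ := Λ) n M)
    (hv : v ≠ 0) (hMS : M ≤ S) (k : ℕ) (hk : (k : ℝ) < M + S + 1) :
    (lowerOn n Finset.univ) ^ k *ᵥ v ∈ spinZSector (Λ := Λ) n (M - k) ∧
      totalSpinSq n *ᵥ ((lowerOn n Finset.univ) ^ k *ᵥ v) =
        ((S * (S + 1) : ℝ) : ℂ) • ((lowerOn n Finset.univ) ^ k *ᵥ v) ∧
      (lowerOn n Finset.univ) ^ k *ᵥ v ≠ 0 := by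
  induction k with
  | zero =>
    simp only [pow_zero, Matrix.one_mulVec, Nat.cast_zero, sub_zero]
    exact ⟨hM, hS, hv⟩
  | succ k ih =>
    have hk' : (k : ℝ) < M + S + 1 := by push_cast at hk; linarith
    obtain ⟨h1, h2, h3⟩ := ih hk'
    refine ⟨?_, ?_, ?_⟩
    · rw [pow_succ', ← mulVec_mulVec]
      have := lowerOn_mulVec_mem n h1
      push_cast at this ⊢
      rwa [show M - (k : ℝ) - 1 = M - (k + 1) by ring] at this
    · rw [pow_succ', ← mulVec_mulVec, mulVec_mulVec, (commute_totalSpinSq_lowerOn n).eq,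
        ← mulVec_mulVec, h2, mulVec_smul]
    · rw [pow_succ', ← mulVec_mulVec]
      refine lowerOn_mulVec_ne_zero n h2 h1 h3 ?_ ?_
      · push_cast at hk; linarith
      · linarith

/-- Iterated raising of a vector of total spin `S ≥ 0` and weight `M ≥ -S`: `(S⁺_tot)^k v` lies in
`𝓗_{M+k}`, has total spin `S`, and is nonzero as long as `k < S - M + 1`. Tasaki (2020) §2.4,
App. A.3. [folklore] -/
theorem raiseOn_pow_mulVec {v : TensorIndex Λ (n + 1) → ℂ} {S M : ℝ}
    (hS : totalSpinSq n *ᵥ v = ((S * (S + 1) : ℝ) : ℂ) • v) (hM : v ∈ spinZSector (Λ := Λ) n M)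
    (hv : v ≠ 0) (hMS : -S ≤ M) (k : ℕ) (hk : (k : ℝ) < S - M + 1) :
    (raiseOn n Finset.univ) ^ k *ᵥ v ∈ spinZSector (Λ := Λ) n (M + k) ∧
      totalSpinSq n *ᵥ ((raiseOn n Finset.univ) ^ k *ᵥ v) =
        ((S * (S + 1) : ℝ) : ℂ) • ((raiseOn n Finset.univ) ^ k *ᵥ v) ∧
      (raiseOn n Finset.univ) ^ k *ᵥ v ≠ 0 := by
  induction k with
  | zero =>
    simp only [pow_zero, Matrix.one_mulVec, Nat.cast_zero, add_zero]
    exact ⟨hM, hS, hv⟩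
  | succ k ih =>
    have hk' : (k : ℝ) < S - M + 1 := by push_cast at hk; linarith
    obtain ⟨h1, h2, h3⟩ := ih hk'
    refine ⟨?_, ?_, ?_⟩
    · rw [pow_succ', ← mulVec_mulVec]
      have := raiseOn_mulVec_mem n h1
      push_cast at this ⊢
      rwa [show M + (k : ℝ) + 1 = M + (k + 1) by ring] at this
    · rw [pow_succ', ← mulVec_mulVec, mulVec_mulVec, (commute_totalSpinSq_raiseOn n).eq,
        ← mulVec_mulVec, h2, mulVec_smul]
    · rw [pow_succ', ← mulVec_mulVec]
      refine raiseOn_mulVec_ne_zero n h2 h1 h3 ?_ ?_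
      · linarith
      · push_cast at hk; linarith

/-! ### Highest-weight vectors -/

/-- **A highest-weight vector of weight `M` has total spin `M`**: `S⁺_tot v = 0`, `S^z_tot v = M v`
imply `(𝐒_tot)² v = M(M+1) v` (`C = S⁻S⁺ + (S^z)² + S^z`). Tasaki (2020) §2.4, App. A.3. [folklore] -/
theorem totalSpinSq_mulVec_of_highest {v : TensorIndex Λ (n + 1) → ℂ} {M : ℝ}
    (hP : raiseOn n Finset.univ *ᵥ v = 0) (hM : v ∈ spinZSector (Λ := Λ) n M) :
    totalSpinSq n *ᵥ v = ((M * (M + 1) : ℝ) : ℂ) • v := by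
  rw [mem_spinZSector_iff_mulVec] at hM
  have h1 : (lowerOn n Finset.univ * raiseOn n Finset.univ) *ᵥ v = 0 := by
    rw [← mulVec_mulVec, hP, mulVec_zero]
  have h2 : (zOn n (Finset.univ : Finset Λ) * zOn n Finset.univ) *ᵥ v = ((M : ℂ) * M) • v := by
    rw [← mulVec_mulVec, hM, mulVec_smul, hM, smul_smul]
  rw [totalSpinSq_eq_su2Casimir, (isSu2Triple_on n Finset.univ).su2Casimir_eq, add_mulVec,
    add_mulVec, h1, h2, hM, add_zero, ← add_smul]
  congr 1
  push_cast; ring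

end Ladder

/-! ## IV. Sector ground states are `(𝐒_tot)²`-eigenvectors; the overlap argument -/

section Overlap

variable {Λ : Type*} [Fintype Λ] [DecidableEq Λ] {n : ℕ} (G : SimpleGraph Λ) [DecidableRel G.Adj]
  {A : Finset Λ} (J : ℝ) {M : ℝ}

/-- **A sector ground state is an eigenvector of `(𝐒_tot)²`** (it is unique up to scalars, and
`(𝐒_tot)²` commutes with `H` and preserves the sector). Lieb–Mattis (1962), proof of Thm 2
("`S` is a good quantum number"); Tasaki (2020) §2.4, proof of Thm 2.3. [folklore] -/
theorem exists_totalSpinSq_mulVec_eq_smul (hG : G.Connected) (hA : G.IsBipartiteWith (A : Set Λ) (↑A)ᶜ)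
    (hJ : 0 < J) (hM : spinZSector (Λ := Λ) n M ≠ ⊥) {v : TensorIndex Λ (n + 1) → ℂ}
    (hv : v ∈ spinZSector (Λ := Λ) n M) (hv0 : v ≠ 0)
    (hHv : heisenbergHamiltonian n G J *ᵥ v =
      ((lowestEnergyInSector n (heisenbergHamiltonian n G J) M : ℝ) : ℂ) • v) :
    ∃ c : ℂ, totalSpinSq n *ᵥ v = c • v := by
  have hw : totalSpinSq n *ᵥ v ∈ spinZSector (Λ := Λ) n M := totalSpinSq_mulVec_mem n hv
  have hHw : heisenbergHamiltonian n G J *ᵥ (totalSpinSq n *ᵥ v) =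
      ((lowestEnergyInSector n (heisenbergHamiltonian n G J) M : ℝ) : ℂ) • (totalSpinSq n *ᵥ v) := by
    rw [mulVec_mulVec, (LiebMattis.commute_heisenbergHamiltonian_totalSpinSq n G J).eq, ← mulVec_mulVec, hHv, mulVec_smul]
  exact liebMattis_sector_unique G J hG hA hJ hM hv hw hv0 hHv hHw

/-- **Orthogonality of eigenvectors of a Hermitian matrix with distinct eigenvalues**, in the
contrapositive form used by Lieb–Mattis: if `T` is Hermitian, `T w = μ w` with `μ` real,
`T v = c v`, and `⟨w, v⟩ ≠ 0`, then `c = μ`. Lieb–Mattis (1962), proof of Thm 2 ("not orthogonal,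
hence same `S`"); Mattis (2006) §5.10. [folklore] -/
theorem eigenvalue_eq_of_dotProduct_ne_zero {ι : Type*} [Fintype ι] {T : Matrix ι ι ℂ}
    (hT : T.IsHermitian) {v w : ι → ℂ} {c : ℂ} {μ : ℝ} (hv : T *ᵥ v = c • v)
    (hw : T *ᵥ w = (μ : ℂ) • w) (hvw : star w ⬝ᵥ v ≠ 0) : c = μ := by
  have h1 : star w ⬝ᵥ (T *ᵥ v) = c * (star w ⬝ᵥ v) := by rw [hv, dotProduct_smul, smul_eq_mul]
  have h2 : star w ⬝ᵥ (T *ᵥ v) = (μ : ℂ) * (star w ⬝ᵥ v) := by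
    have : star w ⬝ᵥ (T *ᵥ v) = star (T *ᵥ w) ⬝ᵥ v := by
      rw [star_mulVec, hT.eq, dotProduct_mulVec]
    rw [this, hw, star_smul, Complex.star_def, Complex.conj_ofReal, smul_dotProduct, smul_eq_mul]
  have h3 : (c - μ) * (star w ⬝ᵥ v) = 0 := by rw [sub_mul, ← h1, ← h2, sub_self]
  rcases mul_eq_zero.1 h3 with h | h
  · exact sub_eq_zero.1 h
  · exact absurd h hvw

/-- A vector whose Marshall-twisted amplitudes are nonnegative reals. (Reference states in the
proof of Lieb–Mattis (1962), Thm 2, have this property; the sector ground state has it strictly.)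
[folklore] -/
def IsMarshallNonneg (A : Finset Λ) (w : TensorIndex Λ (n + 1) → ℂ) : Prop :=
  ∀ σ, 0 ≤ (marshallSign A σ * w σ).re ∧ (marshallSign A σ * w σ).im = 0

/-- **Positive overlap**: a nonzero Marshall-nonnegative vector `w` is not orthogonal to a vector
`v` whose Marshall-twisted amplitudes, after multiplication by a constant `c ≠ 0`, are strictly
positive wherever `w` may be nonzero. Lieb–Mattis (1962), proof of Thm 2; Mattis (2006) §5.10
("nodeless; hence it is not orthogonal"). [folklore] -/
theorem dotProduct_ne_zero_of_marshall {p : TensorIndex Λ (n + 1) → Prop} {v w : TensorIndex Λ (n + 1) → ℂ}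
    (hw : IsMarshallNonneg A w) (hwp : ∀ σ, ¬ p σ → w σ = 0) (hw0 : w ≠ 0) {c : ℂ}
    (hc : ∀ σ, p σ → 0 < (c * (marshallSign A σ * v σ)).re ∧ (c * (marshallSign A σ * v σ)).im = 0) :
    star w ⬝ᵥ v ≠ 0 := by
  classical
  -- `⟨w, c v⟩ = Σ_σ conj(m_σ w_σ) (c m_σ v_σ)` is a sum of nonnegative reals with a positive term
  have hterm : ∀ σ, star (w σ) * (c * v σ) =
      star (marshallSign A σ * w σ) * (c * (marshallSign A σ * v σ)) := by
    intro σ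
    rw [star_mul', star_marshallSign]
    calc star (w σ) * (c * v σ) = star (w σ) * (c * v σ) * (marshallSign A σ * marshallSign A σ) := by
          rw [marshallSign_mul_self, mul_one]
      _ = _ := by ring
  have hre : ∀ σ, (star (marshallSign A σ * w σ) * (c * (marshallSign A σ * v σ))).re =
      (marshallSign A σ * w σ).re * (c * (marshallSign A σ * v σ)).re +
        (marshallSign A σ * w σ).im * (c * (marshallSign A σ * v σ)).im := by
    intro σ
    rw [Complex.mul_re, Complex.star_def, Complex.conj_re, Complex.conj_im]; ring
  have hnn : ∀ σ, 0 ≤ (star (w σ) * (c * v σ)).re := by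
    intro σ
    rw [hterm]
    by_cases hp : p σ
    · obtain ⟨h1, h2⟩ := hc σ hp
      obtain ⟨h3, h4⟩ := hw σ
      rw [hre, h2, h4, mul_zero, add_zero]
      exact mul_nonneg h3 h1.le
    · rw [hwp σ hp, mul_zero, star_zero, zero_mul]; rfl
  obtain ⟨σ₀, hσ₀⟩ := Function.ne_iff.1 hw0
  have hp₀ : p σ₀ := by by_contra h; exact hσ₀ (hwp σ₀ h)
  have hpos : 0 < (star (w σ₀) * (c * v σ₀)).re := by
    rw [hterm]
    obtain ⟨h1, h2⟩ := hc σ₀ hp₀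
    obtain ⟨h3, h4⟩ := hw σ₀
    have h5 : (marshallSign A σ₀ * w σ₀).re ≠ 0 := by
      intro h
      apply hσ₀
      have : marshallSign A σ₀ * w σ₀ = 0 := Complex.ext h h4
      rcases mul_eq_zero.1 this with h6 | h6
      · exact absurd h6 (marshallSign_ne_zero A σ₀)
      · exact h6
    have h3' : 0 < (marshallSign A σ₀ * w σ₀).re := lt_of_le_of_ne h3 (Ne.symm h5)
    rw [hre, h2, h4, mul_zero, add_zero]
    exact mul_pos h3' h1
  intro h0
  have hsum : star w ⬝ᵥ (c • v) = 0 := by rw [dotProduct_smul, h0, smul_zero]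
  rw [dotProduct] at hsum
  have hre : (∑ σ, star w σ * (c • v) σ).re = 0 := by rw [hsum]; rfl
  rw [Complex.re_sum] at hre
  have hlt : 0 < ∑ σ, (star w σ * (c • v) σ).re := by
    rw [← Finset.add_sum_erase _ _ (Finset.mem_univ σ₀)]
    exact add_pos_of_pos_of_nonneg hpos (Finset.sum_nonneg fun σ _ => hnn σ)
  linarith

end Overlap


/-! ## V. Reference states: two-site highest-weight vectors and their products -/

section PairStates

variable {Λ : Type*} [Fintype Λ] [DecidableEq Λ] {q : ℕ}

variable (n : ℕ)

/-- Row sums against `S⁺`: `Σ_l ⟨k|S⁺|l⟩ f(l) = √((k+1)(n-k)) f(k+1)` (and `0` for `k = n`).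
Tasaki (2020) §2.1, eq. (2.1.6). [folklore] -/
theorem sum_spinRaise_mul (k : Fin (n + 1)) (f : Fin (n + 1) → ℂ) :
    ∑ l, spinRaise n k l * f l =
      if h : k.val + 1 < n + 1 then
        (Real.sqrt ((k.val + 1 : ℝ) * (n - k.val : ℝ)) : ℂ) * f ⟨k.val + 1, h⟩ else 0 := by
  split_ifs with h
  · rw [Finset.sum_eq_single ⟨k.val + 1, h⟩]
    · rw [spinRaise_apply, if_pos rfl]
    · intro l _ hl
      rw [spinRaise_apply, if_neg, zero_mul]
      intro hl'; exact hl (Fin.ext hl')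
    · intro h'; exact absurd (Finset.mem_univ _) h'
  · refine Finset.sum_eq_zero fun l _ => ?_
    rw [spinRaise_apply, if_neg, zero_mul]
    intro hl; have := l.isLt; omega

/-- Row sums against `S⁻` (`k ≥ 1`): `Σ_l ⟨k|S⁻|l⟩ f(l) = √(k(n-k+1)) f(k-1)`.
Tasaki (2020) §2.1, eq. (2.1.6). [folklore] -/
theorem sum_spinLower_mul (k : Fin (n + 1)) (f : Fin (n + 1) → ℂ) (hk : 0 < k.val) :
    ∑ l, spinLower n k l * f l =
      (Real.sqrt (((k.val - 1 : ℕ) + 1 : ℝ) * (n - (k.val - 1 : ℕ) : ℝ)) : ℂ) *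
        f ⟨k.val - 1, by omega⟩ := by
  rw [Finset.sum_eq_single ⟨k.val - 1, by omega⟩]
  · rw [spinLower_apply, if_pos (by change k.val = (k.val - 1) + 1; omega)]
  · intro l _ hl
    rw [spinLower_apply, if_neg, zero_mul]
    intro hl'; exact hl (Fin.ext (by change l.val = k.val - 1; omega))
  · intro h'; exact absurd (Finset.mem_univ _) h'

/-- For `k = 0` the row of `S⁻` vanishes. [folklore] -/
theorem sum_spinLower_mul_of_eq_zero (k : Fin (n + 1)) (f : Fin (n + 1) → ℂ) (hk : k.val = 0) :
    ∑ l, spinLower n k l * f l = 0 := by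
  refine Finset.sum_eq_zero fun l _ => ?_
  rw [spinLower_apply, if_neg, zero_mul]
  omega

/-- The moduli `c_k ≥ 0` of the amplitudes of the highest-weight vector of spin `j` in
`(spin n/2) ⊗ (spin n/2)`, normalised by `c_0 = 1` and defined by the recursion
`c_{k+1} √((k+1)(n-k)) = c_k √((n-j-k)(j+k+1))` forced by `(S⁺_1 + S⁺_2) v = 0`
(Clebsch–Gordan coefficients `⟨s, s-k; s, m₂ | j, j⟩` up to normalisation; Messiah,
*Quantum Mechanics* II, App. C; Tasaki (2020) App. A.3). [folklore] -/
def hwAbs (n j : ℕ) : ℕ → ℝ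
  | 0 => 1
  | k + 1 => hwAbs n j k *
      (Real.sqrt ((n - j - k : ℝ) * (j + k + 1)) / Real.sqrt ((k + 1 : ℝ) * (n - k)))

/-- `c_k ≥ 0`. [folklore] -/
theorem hwAbs_nonneg (n j k : ℕ) : 0 ≤ hwAbs n j k := by
  induction k with
  | zero => exact zero_le_one
  | succ k ih => exact mul_nonneg ih (div_nonneg (Real.sqrt_nonneg _) (Real.sqrt_nonneg _))

/-- The recursion `c_{k+1} √((k+1)(n-k)) = c_k √((n-j-k)(j+k+1))` (`k < n`). [folklore] -/
theorem hwAbs_succ_mul {n k : ℕ} (j : ℕ) (hk : k < n) :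
    hwAbs n j (k + 1) * Real.sqrt ((k + 1 : ℝ) * (n - k)) =
      hwAbs n j k * Real.sqrt ((n - j - k : ℝ) * (j + k + 1)) := by
  have hpos : 0 < Real.sqrt ((k + 1 : ℝ) * (n - k)) := by
    apply Real.sqrt_pos.2
    have : (k : ℝ) + 1 ≤ n := by exact_mod_cast hk
    exact mul_pos (by positivity) (by linarith)
  rw [hwAbs, mul_assoc, div_mul_cancel₀ _ hpos.ne']

/-- For the singlet (`j = 0`) all moduli are `1`: `c_k = 1` for `k ≤ n`. [folklore] -/
theorem hwAbs_zero_eq_one {n k : ℕ} (hk : k ≤ n) : hwAbs n 0 k = 1 := by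
  induction k with
  | zero => rfl
  | succ k ih =>
    have hpos : 0 < Real.sqrt ((k + 1 : ℝ) * (n - k)) := by
      apply Real.sqrt_pos.2
      have : (k : ℝ) + 1 ≤ n := by exact_mod_cast hk
      exact mul_pos (by positivity) (by linarith)
    rw [hwAbs, ih (Nat.le_of_succ_le hk), one_mul, Nat.cast_zero, sub_zero, zero_add,
      show ((n : ℝ) - k) * (k + 1) = (k + 1) * (n - k) by ring, div_self hpos.ne']

/-- **The two-site highest-weight vector of spin `j`** in the product basis `|k⟩ ⊗ |l⟩`
(`k, l = S - m`): amplitude `(-1)^k c_k` on `k + l = n - j` (total `S^z = j`), zero otherwise;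
for `j = 0` this is the singlet `Σ_k (-1)^k |k⟩|n-k⟩`. The first tensor factor will sit on the
`A`-site of a pair, so that `(-1)^k` is exactly the Marshall sign. Lieb–Mattis (1962), proof of
Thm 2 (ground state of the soluble reference model); Tasaki (2020) §2.4, App. A.3. [folklore] -/
def pairAmp (n j : ℕ) (k l : Fin (n + 1)) : ℂ :=
  if k.val + l.val + j = n then (((-1 : ℝ) ^ k.val * hwAbs n j k.val : ℝ) : ℂ) else 0

/-- **Highest weight of the pair vector**: `(S⁺ ⊗ 1 + 1 ⊗ S⁺)` annihilates it; on amplitudes,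
`Σ_l ⟨k'|S⁺|l⟩ a(k, l) + Σ_l ⟨k|S⁺|l⟩ a(l, k') = 0` for all `k, k'`. Tasaki (2020) §2.4,
App. A.3. [folklore] -/
theorem pairAmp_raise (j : ℕ) (k k' : Fin (n + 1)) :
    (∑ l, spinRaise n k' l * pairAmp n j k l) + ∑ l, spinRaise n k l * pairAmp n j l k' = 0 := by
  by_cases hC : k.val + k'.val + 1 + j = n
  · have hk : k.val + 1 < n + 1 := by omega
    have hk' : k'.val + 1 < n + 1 := by omega
    rw [sum_spinRaise_mul, sum_spinRaise_mul, dif_pos hk', dif_pos hk]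
    simp only [pairAmp]
    rw [if_pos (by omega), if_pos (by omega)]
    have hrec := hwAbs_succ_mul j (show k.val < n by omega)
    have e1 : ((k'.val : ℝ) + 1) * (n - k'.val) = (n - j - k.val) * (j + k.val + 1) := by
      have h1 : ((k'.val : ℝ) + 1) = n - j - k.val := by
        have : k'.val + 1 + j + k.val = n := by omega
        have : ((k'.val : ℝ) + 1 + j + k.val) = n := by exact_mod_cast this
        linarith
      have h2 : ((n : ℝ) - k'.val) = j + k.val + 1 := by linarith
      rw [h1, h2]
    rw [e1, ← Complex.ofReal_mul, ← Complex.ofReal_mul, ← Complex.ofReal_add, Complex.ofReal_eq_zero,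
      pow_succ]
    linear_combination (-((-1 : ℝ) ^ k.val)) * hrec
  · have h1 : ∑ l, spinRaise n k' l * pairAmp n j k l = 0 := by
      refine Finset.sum_eq_zero fun l _ => ?_
      by_cases hl : l.val = k'.val + 1
      · rw [pairAmp, if_neg (by omega), mul_zero]
      · rw [spinRaise_apply, if_neg hl, zero_mul]
    have h2 : ∑ l, spinRaise n k l * pairAmp n j l k' = 0 := by
      refine Finset.sum_eq_zero fun l _ => ?_
      by_cases hl : l.val = k.val + 1
      · rw [pairAmp, if_neg (by omega), mul_zero]
      · rw [spinRaise_apply, if_neg hl, zero_mul]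
    rw [h1, h2, add_zero]

/-- **The singlet is also lowest weight**: `(S⁻ ⊗ 1 + 1 ⊗ S⁻)` annihilates the `j = 0` pair
vector; on amplitudes, `Σ_l ⟨k'|S⁻|l⟩ a(k, l) + Σ_l ⟨k|S⁻|l⟩ a(l, k') = 0`. Tasaki (2020) §2.4. [folklore] -/
theorem pairAmp_lower (k k' : Fin (n + 1)) :
    (∑ l, spinLower n k' l * pairAmp n 0 k l) + ∑ l, spinLower n k l * pairAmp n 0 l k' = 0 := by
  by_cases hC : k.val + k'.val = n + 1
  · have hk : 0 < k.val := by have := k'.isLt; omega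
    have hk' : 0 < k'.val := by have := k.isLt; omega
    rw [sum_spinLower_mul n k' _ hk', sum_spinLower_mul n k _ hk]
    simp only [pairAmp, add_zero]
    rw [if_pos (by omega), if_pos (by omega), hwAbs_zero_eq_one (show k.val ≤ n by omega),
      hwAbs_zero_eq_one (show k.val - 1 ≤ n by omega), mul_one, mul_one]
    have e1 : ((k'.val - 1 : ℕ) : ℝ) = n - k.val := by
      rw [show k'.val - 1 = n - k.val by omega, Nat.cast_sub (show k.val ≤ n by omega)]
    have e2 : ((k.val - 1 : ℕ) : ℝ) = n - k'.val := by
      rw [show k.val - 1 = n - k'.val by omega, Nat.cast_sub (show k'.val ≤ n by omega)]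
    have e3 : ((n : ℝ) - k.val + 1) * (n - (n - k.val)) = (n - k'.val + 1) * (n - (n - k'.val)) := by
      have : (k.val : ℝ) + k'.val = n + 1 := by exact_mod_cast hC
      nlinarith
    have e4 : (-1 : ℝ) ^ k.val = -(-1 : ℝ) ^ (k.val - 1) := by
      conv_lhs => rw [show k.val = (k.val - 1) + 1 by omega, pow_succ]
      ring
    rw [e1, e2, e3, e4, ← Complex.ofReal_mul, ← Complex.ofReal_mul, ← Complex.ofReal_add,
      Complex.ofReal_eq_zero]
    ring
  · have h1 : ∑ l, spinLower n k' l * pairAmp n 0 k l = 0 := by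
      refine Finset.sum_eq_zero fun l _ => ?_
      by_cases hl : k'.val = l.val + 1
      · rw [pairAmp, if_neg (by omega), mul_zero]
      · rw [spinLower_apply, if_neg hl, zero_mul]
    have h2 : ∑ l, spinLower n k l * pairAmp n 0 l k' = 0 := by
      refine Finset.sum_eq_zero fun l _ => ?_
      by_cases hl : k.val = l.val + 1
      · rw [pairAmp, if_neg (by omega), mul_zero]
      · rw [spinLower_apply, if_neg hl, zero_mul]
    rw [h1, h2, add_zero]

/-- The pair amplitudes are Marshall-signed nonnegative reals: `(-1)^k a(k, l) ≥ 0`. [folklore] -/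
theorem pairAmp_sign (j : ℕ) (k l : Fin (n + 1)) :
    0 ≤ ((((-1 : ℝ) ^ k.val : ℝ) : ℂ) * pairAmp n j k l).re ∧
      ((((-1 : ℝ) ^ k.val : ℝ) : ℂ) * pairAmp n j k l).im = 0 := by
  unfold pairAmp
  split_ifs
  · rw [← Complex.ofReal_mul, Complex.ofReal_re, Complex.ofReal_im, ← mul_assoc, ← pow_add,
      ← two_mul, pow_mul]
    norm_num
    exact hwAbs_nonneg n j _
  · simp

/-- The pair amplitude on the "stretched" configuration `(0, n - j)` is `1`. [folklore] -/
theorem pairAmp_zero_left (j : ℕ) (l : Fin (n + 1)) (hl : l.val + j = n) :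
    pairAmp n j 0 l = 1 := by
  rw [pairAmp, if_pos (by simp; omega)]
  simp [hwAbs]

/-- Support of the pair amplitude: `a(k, l) ≠ 0 → k + l + j = n`. [folklore] -/
theorem pairAmp_ne_zero {j : ℕ} {k l : Fin (n + 1)} (h : pairAmp n j k l ≠ 0) :
    k.val + l.val + j = n := by
  by_contra hc; exact h (if_neg hc)

end PairStates

/-! ### Pairings of the smaller sublattice into the larger one, and the product reference state -/

section Reference

variable {Λ : Type*} [Fintype Λ] [DecidableEq Λ]

/-- A **pairing** of the sublattice `Aᶜ` into `A`: an assignment `b ↦ e b ∈ A`, injective on `Aᶜ`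
(exists iff `|Aᶜ| ≤ |A|`). Each pair `{e b, b}` will carry a two-site highest-weight state and the
unpaired sites of `A` a fully polarised spin, as in the ground state of the soluble reference model of
Lieb–Mattis (1962), proof of Thm 2 (Mattis (2006) §5.10, eq. (5.175): `S_A`, `S_B` maximal,
`S_T` minimal). [folklore] -/
structure IsPairing (A : Finset Λ) (e : Λ → Λ) : Prop where
  /-- partners lie in `A` -/
  mem : ∀ b, b ∉ A → e b ∈ A
  /-- distinct sites of `Aᶜ` have distinct partners -/
  inj : ∀ b₁, b₁ ∉ A → ∀ b₂, b₂ ∉ A → e b₁ = e b₂ → b₁ = b₂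

/-- A pairing exists when `|Aᶜ| ≤ |A|`. [folklore] -/
theorem exists_isPairing (A : Finset Λ) (h : Aᶜ.card ≤ A.card) : ∃ e : Λ → Λ, IsPairing A e := by
  have hc : Fintype.card (Aᶜ : Finset Λ) ≤ Fintype.card A := by simpa only [Fintype.card_coe] using h
  obtain ⟨f⟩ := Function.Embedding.nonempty_of_card_le hc
  refine ⟨fun b => if hb : b ∈ Aᶜ then ((f ⟨b, hb⟩ : A) : Λ) else b, fun b hb => ?_,
    fun b₁ hb₁ b₂ hb₂ h12 => ?_⟩
  · have hb' : b ∈ Aᶜ := Finset.mem_compl.2 hb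
    simp only [dif_pos hb']
    exact (f ⟨b, hb'⟩).2
  · have hb₁' : b₁ ∈ Aᶜ := Finset.mem_compl.2 hb₁
    have hb₂' : b₂ ∈ Aᶜ := Finset.mem_compl.2 hb₂
    simp only [dif_pos hb₁', dif_pos hb₂'] at h12
    have := f.injective (Subtype.ext h12)
    exact congrArg Subtype.val this

namespace IsPairing

variable {A : Finset Λ} {e : Λ → Λ}

omit [Fintype Λ] [DecidableEq Λ] in
/-- A partner is never the paired site itself (they lie in different sublattices). [folklore] -/
theorem apply_ne (hp : IsPairing A e) {b b' : Λ} (hb : b ∉ A) (hb' : b' ∉ A) : e b ≠ b' :=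
  ne_of_mem_of_not_mem (hp.mem b hb) hb'

/-- The image of `Aᶜ` lies in `A`. [folklore] -/
theorem image_subset (hp : IsPairing A e) : Aᶜ.image e ⊆ A := by
  intro a ha
  obtain ⟨b, hb, rfl⟩ := Finset.mem_image.1 ha
  exact hp.mem b (Finset.mem_compl.1 hb)

/-- `e` is injective on `Aᶜ` (Finset form). [folklore] -/
theorem injOn (hp : IsPairing A e) : ∀ b₁ ∈ Aᶜ, ∀ b₂ ∈ Aᶜ, e b₁ = e b₂ → b₁ = b₂ :=
  fun b₁ hb₁ b₂ hb₂ h => hp.inj b₁ (Finset.mem_compl.1 hb₁) b₂ (Finset.mem_compl.1 hb₂) h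

end IsPairing

variable (n : ℕ) (A : Finset Λ) (e : Λ → Λ) (j : Λ → ℕ)

/-- The **unpaired sites** of `A`. [folklore] -/
def freeSites : Finset Λ := A \ Aᶜ.image e

/-- The **paired sites** `Aᶜ ∪ e(Aᶜ)`. [folklore] -/
def pairedSites : Finset Λ := Aᶜ ∪ Aᶜ.image e

variable {A e} in
/-- Membership in the unpaired sites. [folklore] -/
theorem mem_freeSites {a : Λ} : a ∈ freeSites A e ↔ a ∈ A ∧ ∀ b, b ∉ A → e b ≠ a := by
  simp only [freeSites, Finset.mem_sdiff, Finset.mem_image, Finset.mem_compl, not_exists, not_and]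

variable {A e} in
/-- A site of `Aᶜ` is not unpaired. [folklore] -/
theorem not_mem_freeSites_of_not_mem {b : Λ} (hb : b ∉ A) : b ∉ freeSites A e := fun h =>
  hb (mem_freeSites.1 h).1

variable {A e} in
/-- A partner is not unpaired. [folklore] -/
theorem apply_not_mem_freeSites {b : Λ} (hb : b ∉ A) : e b ∉ freeSites A e := fun h =>
  (mem_freeSites.1 h).2 b hb rfl

/-- The unpaired sites are the complement of the paired ones. [folklore] -/
theorem compl_freeSites : (freeSites A e)ᶜ = pairedSites A e := by
  ext x
  simp only [freeSites, pairedSites, Finset.mem_compl, Finset.mem_sdiff, Finset.mem_union,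
    not_and, not_not]
  tauto

/-- The pair part `Π_{b ∈ Aᶜ} a_{j_b}(σ_{e b}, σ_b)` of the reference amplitude. [folklore] -/
def pairProd (σ : TensorIndex Λ (n + 1)) : ℂ := ∏ b ∈ Aᶜ, pairAmp n (j b) (σ (e b)) (σ b)

/-- The free part `Π_{a unpaired} [σ_a = 0]` (unpaired spins fully up) of the reference amplitude. [folklore] -/
def freeProd (σ : TensorIndex Λ (n + 1)) : ℂ := ∏ a ∈ freeSites A e, if (σ a).val = 0 then 1 else 0

/-- **The product reference state** `R = ⨂_{b ∈ Aᶜ} (pair state of spin j_b on {e b, b}) ⊗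
⨂_{a unpaired} |↑⟩_a`, by its amplitudes in the product basis. This is (a convenient stand-in
for) the ground state of the soluble reference Hamiltonian in the sector `M = S₀ + Σ_b j_b` of
Lieb–Mattis (1962), proof of Thm 2; Mattis (2006) §5.10, eqs. (5.174)–(5.176). [folklore] -/
def refVec : TensorIndex Λ (n + 1) → ℂ := fun σ => pairProd n A e j σ * freeProd n A e σ

variable {n A e j}

/-- Unfolding `refVec`. [folklore] -/
theorem refVec_apply (σ : TensorIndex Λ (n + 1)) :
    refVec n A e j σ = pairProd n A e j σ * freeProd n A e σ := rfl

/-! #### How updating one site changes the two factors -/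

/-- Splitting off the pair of `b₀`. [folklore] -/
theorem pairProd_eq {b₀ : Λ} (hb₀ : b₀ ∉ A) (σ : TensorIndex Λ (n + 1)) :
    pairProd n A e j σ = pairAmp n (j b₀) (σ (e b₀)) (σ b₀) *
      ∏ b ∈ Aᶜ.erase b₀, pairAmp n (j b) (σ (e b)) (σ b) := by
  rw [pairProd, ← Finset.mul_prod_erase _ _ (Finset.mem_compl.2 hb₀)]

/-- Updating the `Aᶜ`-site `b₀` of a pair. [folklore] -/
theorem pairProd_update_right (hp : IsPairing A e) {b₀ : Λ} (hb₀ : b₀ ∉ A)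
    (σ : TensorIndex Λ (n + 1)) (l : Fin (n + 1)) :
    pairProd n A e j (Function.update σ b₀ l) = pairAmp n (j b₀) (σ (e b₀)) l *
      ∏ b ∈ Aᶜ.erase b₀, pairAmp n (j b) (σ (e b)) (σ b) := by
  rw [pairProd_eq hb₀, Function.update_self, Function.update_of_ne (hp.apply_ne hb₀ hb₀)]
  congr 1
  refine Finset.prod_congr rfl fun b hb => ?_
  have hbA : b ∉ A := Finset.mem_compl.1 (Finset.mem_of_mem_erase hb)
  rw [Function.update_of_ne (hp.apply_ne hbA hb₀), Function.update_of_ne (Finset.ne_of_mem_erase hb)]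

/-- Updating the `A`-site `e b₀` of a pair. [folklore] -/
theorem pairProd_update_left (hp : IsPairing A e) {b₀ : Λ} (hb₀ : b₀ ∉ A)
    (σ : TensorIndex Λ (n + 1)) (l : Fin (n + 1)) :
    pairProd n A e j (Function.update σ (e b₀) l) = pairAmp n (j b₀) l (σ b₀) *
      ∏ b ∈ Aᶜ.erase b₀, pairAmp n (j b) (σ (e b)) (σ b) := by
  rw [pairProd_eq hb₀, Function.update_self, Function.update_of_ne (hp.apply_ne hb₀ hb₀).symm]
  congr 1
  refine Finset.prod_congr rfl fun b hb => ?_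
  have hbA : b ∉ A := Finset.mem_compl.1 (Finset.mem_of_mem_erase hb)
  have h1 : e b ≠ e b₀ := fun h => Finset.ne_of_mem_erase hb (hp.inj b hbA b₀ hb₀ h)
  rw [Function.update_of_ne h1, Function.update_of_ne (hp.apply_ne hb₀ hbA).symm]

/-- Updating an unpaired site does not change the pair part. [folklore] -/
theorem pairProd_update_free {a : Λ} (ha : a ∈ freeSites A e) (σ : TensorIndex Λ (n + 1))
    (l : Fin (n + 1)) : pairProd n A e j (Function.update σ a l) = pairProd n A e j σ := by
  obtain ⟨haA, hae⟩ := mem_freeSites.1 ha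
  refine Finset.prod_congr rfl fun b hb => ?_
  have hbA : b ∉ A := Finset.mem_compl.1 hb
  rw [Function.update_of_ne (hae b hbA), Function.update_of_ne (ne_of_mem_of_not_mem haA hbA).symm]

/-- Updating a paired site does not change the free part. [folklore] -/
theorem freeProd_update_of_not_mem {x : Λ} (hx : x ∉ freeSites A e) (σ : TensorIndex Λ (n + 1))
    (l : Fin (n + 1)) : freeProd n A e (Function.update σ x l) = freeProd n A e σ := by
  refine Finset.prod_congr rfl fun a ha => ?_
  rw [Function.update_of_ne (ne_of_mem_of_not_mem ha hx)]

/-- Splitting off the unpaired site `a₀`. [folklore] -/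
theorem freeProd_eq {a₀ : Λ} (ha₀ : a₀ ∈ freeSites A e) (σ : TensorIndex Λ (n + 1)) :
    freeProd n A e σ = (if (σ a₀).val = 0 then 1 else 0) *
      ∏ a ∈ (freeSites A e).erase a₀, (if (σ a).val = 0 then (1 : ℂ) else 0) := by
  rw [freeProd, ← Finset.mul_prod_erase _ _ ha₀]

/-- Updating the unpaired site `a₀`. [folklore] -/
theorem freeProd_update_self {a₀ : Λ} (ha₀ : a₀ ∈ freeSites A e) (σ : TensorIndex Λ (n + 1))
    (l : Fin (n + 1)) :
    freeProd n A e (Function.update σ a₀ l) = (if l.val = 0 then 1 else 0) *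
      ∏ a ∈ (freeSites A e).erase a₀, (if (σ a).val = 0 then (1 : ℂ) else 0) := by
  rw [freeProd_eq ha₀, Function.update_self]
  congr 1
  refine Finset.prod_congr rfl fun a ha => ?_
  rw [Function.update_of_ne (Finset.ne_of_mem_erase ha)]

/-! #### The reference state is a highest-weight vector; the singlet reference is also lowest weight -/

/-- Sum over all sites = sum over `Aᶜ`, plus its partners, plus the unpaired sites. [folklore] -/
theorem sum_univ_eq_pairing (hp : IsPairing A e) (g : Λ → ℂ) :
    ∑ x, g x = ∑ b ∈ Aᶜ, (g b + g (e b)) + ∑ a ∈ freeSites A e, g a := by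
  rw [← Finset.sum_add_sum_compl Aᶜ, compl_compl, ← Finset.sum_sdiff hp.image_subset,
    Finset.sum_image hp.injOn, Finset.sum_add_distrib, freeSites]
  ring

/-- **The reference state is a highest-weight vector**: `S⁺_tot R = 0` (each pair is a highest-weight
vector, `pairAmp_raise`, and `S⁺|↑⟩ = 0` on the unpaired sites). Lieb–Mattis (1962), proof of Thm 2;
Tasaki (2020) §2.4. [folklore] -/
theorem raiseOn_mulVec_refVec (hp : IsPairing A e) :
    raiseOn n Finset.univ *ᵥ refVec n A e j = 0 := by
  funext σ
  rw [Pi.zero_apply, raiseOn, Matrix.sum_mulVec, Finset.sum_apply]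
  simp only [LiebMattis.onSite_mulVec_apply]
  rw [sum_univ_eq_pairing hp]
  have hpair : ∀ b ∈ Aᶜ, (∑ l, spinRaise n (σ b) l * refVec n A e j (Function.update σ b l)) +
      ∑ l, spinRaise n (σ (e b)) l * refVec n A e j (Function.update σ (e b) l) = 0 := by
    intro b hb
    have hbA : b ∉ A := Finset.mem_compl.1 hb
    simp only [refVec_apply, pairProd_update_right hp hbA, pairProd_update_left hp hbA,
      freeProd_update_of_not_mem (not_mem_freeSites_of_not_mem hbA),
      freeProd_update_of_not_mem (apply_not_mem_freeSites hbA)]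
    simp only [← mul_assoc, ← Finset.sum_mul]
    rw [← add_mul, ← add_mul, pairAmp_raise, zero_mul, zero_mul]
  have hfree : ∀ a ∈ freeSites A e,
      ∑ l, spinRaise n (σ a) l * refVec n A e j (Function.update σ a l) = 0 := by
    intro a ha
    refine Finset.sum_eq_zero fun l _ => ?_
    by_cases hl : l.val = (σ a).val + 1
    · rw [refVec_apply, freeProd_update_self ha, if_neg (by omega), zero_mul, mul_zero, mul_zero]
    · rw [spinRaise_apply, if_neg hl, zero_mul]
  rw [Finset.sum_eq_zero hpair, Finset.sum_eq_zero hfree, add_zero]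

/-- **The singlet reference state is annihilated by the lowering operators of the paired sites**:
`S⁻_{pairs} R₀ = 0` for `j ≡ 0` (`pairAmp_lower`). Tasaki (2020) §2.4. [folklore] -/
theorem lowerOn_pairedSites_mulVec_refVec (hp : IsPairing A e) :
    lowerOn n (pairedSites A e) *ᵥ refVec n A e (fun _ => 0) = 0 := by
  funext σ
  rw [Pi.zero_apply, lowerOn, Matrix.sum_mulVec, Finset.sum_apply]
  simp only [LiebMattis.onSite_mulVec_apply]
  have hdisj : Disjoint Aᶜ (Aᶜ.image e) := by
    rw [Finset.disjoint_left]
    intro b hb hb'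
    exact Finset.mem_compl.1 hb (hp.image_subset hb')
  rw [pairedSites, Finset.sum_union hdisj, Finset.sum_image hp.injOn, ← Finset.sum_add_distrib]
  refine Finset.sum_eq_zero fun b hb => ?_
  have hbA : b ∉ A := Finset.mem_compl.1 hb
  simp only [refVec_apply, pairProd_update_right hp hbA, pairProd_update_left hp hbA,
    freeProd_update_of_not_mem (not_mem_freeSites_of_not_mem hbA),
    freeProd_update_of_not_mem (apply_not_mem_freeSites hbA)]
  simp only [← mul_assoc, ← Finset.sum_mul]
  rw [← add_mul, ← add_mul, pairAmp_lower, zero_mul, zero_mul]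

/-! #### Support, weight and nonvanishing -/

/-- Where the reference amplitude is nonzero, every pair is "on shell" (`σ_{e b} + σ_b + j_b = n`)
and every unpaired spin is up. [folklore] -/
theorem refVec_ne_zero_iff_aux {σ : TensorIndex Λ (n + 1)} (hσ : refVec n A e j σ ≠ 0) :
    (∀ b, b ∉ A → (σ (e b)).val + (σ b).val + j b = n) ∧ ∀ a ∈ freeSites A e, (σ a).val = 0 := by
  obtain ⟨h1, h2⟩ := mul_ne_zero_iff.1 hσ
  rw [pairProd, Finset.prod_ne_zero_iff] at h1
  rw [freeProd, Finset.prod_ne_zero_iff] at h2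
  refine ⟨fun b hb => pairAmp_ne_zero n (h1 b (Finset.mem_compl.2 hb)), fun a ha => ?_⟩
  by_contra h
  exact h2 a ha (if_neg h)

/-- The total label `Σ_x σ_x` on the support of the reference state. [folklore] -/
theorem sum_val_of_refVec_ne_zero (hp : IsPairing A e)
    {σ : TensorIndex Λ (n + 1)} (hσ : refVec n A e j σ ≠ 0) :
    ((∑ x, (σ x).val : ℕ) : ℝ) = ∑ b ∈ Aᶜ, ((n : ℝ) - j b) := by
  obtain ⟨h1, h2⟩ := refVec_ne_zero_iff_aux hσ
  have h := sum_univ_eq_pairing hp (fun x => (((σ x).val : ℕ) : ℂ))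
  have h3 : ∑ a ∈ freeSites A e, (((σ a).val : ℕ) : ℂ) = 0 :=
    Finset.sum_eq_zero fun a ha => by rw [h2 a ha, Nat.cast_zero]
  rw [h3, add_zero] at h
  have h4 : ∀ b ∈ Aᶜ, (((σ b).val : ℕ) : ℂ) + (((σ (e b)).val : ℕ) : ℂ) = (n : ℂ) - j b := by
    intro b hb
    have := h1 b (Finset.mem_compl.1 hb)
    have : (((σ (e b)).val : ℕ) : ℂ) + (σ b).val + j b = n := by exact_mod_cast this
    linear_combination this
  rw [Finset.sum_congr rfl h4] at h
  apply Complex.ofReal_injective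
  push_cast
  exact_mod_cast h

/-- **Weight of the reference state**: it lies in the sector
`M = (|A| - |Aᶜ|) n/2 + Σ_{b ∈ Aᶜ} j_b = S₀ + Σ_b j_b`. [folklore] -/
theorem refVec_mem_spinZSector (hp : IsPairing A e) :
    refVec n A e j ∈ spinZSector (Λ := Λ) n
      (((A.card : ℝ) - Aᶜ.card) * n / 2 + ∑ b ∈ Aᶜ, (j b : ℝ)) := by
  rw [mem_spinZSector_iff]
  intro σ hσ
  by_contra h
  apply hσ
  have hsum := sum_val_of_refVec_ne_zero hp h
  rw [mag, Finset.sum_sub_distrib, Finset.sum_const, Finset.card_univ, nsmul_eq_mul]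
  have hcard : (Fintype.card Λ : ℝ) = A.card + Aᶜ.card := by
    rw [← Finset.card_add_card_compl A]; push_cast; rfl
  have hsum' : ∑ x, (((σ x : ℕ) : ℕ) : ℝ) = ∑ b ∈ Aᶜ, ((n : ℝ) - j b) := by
    rw [← hsum]; push_cast; rfl
  rw [hcard, hsum', Finset.sum_sub_distrib, Finset.sum_const, nsmul_eq_mul]
  ring

/-- **The reference state is nonzero**: its amplitude on the stretched configuration
(`σ_{e b} = 0`, `σ_b = n - j_b`, unpaired spins up) is `1`. [folklore] -/
theorem refVec_ne_zero (hp : IsPairing A e) (hj : ∀ b, b ∉ A → j b ≤ n) : refVec n A e j ≠ 0 := by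
  set σ₀ : TensorIndex Λ (n + 1) := fun x => if x ∈ A then 0 else ⟨n - j x, by omega⟩ with hσ₀
  have h : refVec n A e j σ₀ = 1 := by
    rw [refVec_apply, pairProd, freeProd, Finset.prod_eq_one, Finset.prod_eq_one, mul_one]
    · intro a ha
      have haA : a ∈ A := (mem_freeSites.1 ha).1
      simp [hσ₀, haA]
    · intro b hb
      have hbA : b ∉ A := Finset.mem_compl.1 hb
      have h1 : σ₀ (e b) = 0 := by simp [hσ₀, hp.mem b hbA]
      have h2 : σ₀ b = ⟨n - j b, by omega⟩ := by simp [hσ₀, hbA]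
      rw [h1, h2]
      exact pairAmp_zero_left n (j b) _ (by change n - j b + j b = n; have := hj b hbA; omega)
  intro h0
  rw [h0] at h
  exact one_ne_zero h.symm

/-! #### Marshall sign of the reference state -/

/-- The Marshall-signed pair amplitude is a nonnegative real: `(-1)^k a_j(k, l) = [k+l+j=n] c_k`.
[folklore] -/
theorem neg_one_pow_mul_pairAmp (j : ℕ) (k l : Fin (n + 1)) :
    (((-1 : ℝ) ^ k.val : ℝ) : ℂ) * pairAmp n j k l =
      ((if k.val + l.val + j = n then hwAbs n j k.val else 0 : ℝ) : ℂ) := by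
  unfold pairAmp
  split_ifs
  · rw [← Complex.ofReal_mul, ← mul_assoc, ← pow_add, ← two_mul, pow_mul]
    norm_num
  · rw [mul_zero, Complex.ofReal_zero]

/-- **The reference state obeys the Marshall sign rule**: `marshallSign(σ) R(σ) ≥ 0` for all `σ`
(the factor `(-1)^{σ_{e b}}` of the Marshall sign is the sign of the pair amplitude, and the
unpaired spins of `A` are up). Lieb–Mattis (1962), proof of Thm 2 ("nodeless"); Marshall (1955). [folklore] -/
theorem isMarshallNonneg_refVec (hp : IsPairing A e) : IsMarshallNonneg A (refVec n A e j) := by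
  intro σ
  -- the Marshall sign splits over partners and unpaired sites
  have hms : marshallSign A σ = (∏ b ∈ Aᶜ, (((-1 : ℝ) ^ (σ (e b)).val : ℝ) : ℂ)) *
      (-1) ^ (∑ a ∈ freeSites A e, (σ a : ℕ)) := by
    rw [marshallSign, ← Finset.sum_sdiff hp.image_subset, Finset.sum_image hp.injOn, add_comm,
      pow_add, ← Finset.prod_pow_eq_pow_sum Aᶜ (fun b => (σ (e b) : ℕ)) (-1 : ℂ)]
    push_cast
    rfl
  by_cases hfree : ∀ a ∈ freeSites A e, (σ a).val = 0
  · have hF : freeProd n A e σ = 1 := Finset.prod_eq_one fun a ha => if_pos (hfree a ha)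
    have hF' : ∑ a ∈ freeSites A e, (σ a : ℕ) = 0 := Finset.sum_eq_zero hfree
    rw [refVec_apply, hF, mul_one, hms, hF', pow_zero, mul_one, pairProd, ← Finset.prod_mul_distrib]
    simp only [neg_one_pow_mul_pairAmp]
    rw [← Complex.ofReal_prod, Complex.ofReal_re, Complex.ofReal_im]
    exact ⟨Finset.prod_nonneg fun b _ => by split_ifs; exacts [hwAbs_nonneg _ _ _, le_rfl], rfl⟩
  · have hF : freeProd n A e σ = 0 := by
      push Not at hfree
      obtain ⟨a, ha, ha0⟩ := hfree
      exact Finset.prod_eq_zero ha (if_neg ha0)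
    rw [refVec_apply, hF, mul_zero, mul_zero]
    simp

omit [Fintype Λ] [DecidableEq Λ] in
/-- `IsMarshallNonneg` is stable under multiplication by a nonnegative real. [folklore] -/
theorem IsMarshallNonneg.smul {w : TensorIndex Λ (n + 1) → ℂ} (hw : IsMarshallNonneg A w)
    {r : ℝ} (hr : 0 ≤ r) : IsMarshallNonneg A ((r : ℂ) • w) := by
  intro σ
  obtain ⟨h1, h2⟩ := hw σ
  rw [Pi.smul_apply, smul_eq_mul, mul_left_comm, Complex.re_ofReal_mul, Complex.im_ofReal_mul, h2,
    mul_zero]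
  exact ⟨mul_nonneg hr h1, rfl⟩

/-! #### Lowering the unpaired spins keeps the Marshall sign -/

omit [Fintype Λ] in
/-- A lowering `S⁻_a` at a site `a ∈ A` connects configurations of opposite Marshall sign: if
`⟨σ| S⁻_a |τ⟩ ≠ 0` then `marshallSign τ = - marshallSign σ`. [folklore] -/
theorem marshallSign_update_of_mem {a : Λ} (ha : a ∈ A) (σ : TensorIndex Λ (n + 1))
    {l : Fin (n + 1)} (hl : (σ a).val = l.val + 1) :
    marshallSign A (Function.update σ a l) = -marshallSign A σ := by
  rw [marshallSign, marshallSign, ← Finset.add_sum_erase A _ ha, ← Finset.add_sum_erase A _ ha,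
    Function.update_self]
  have hrest : ∑ x ∈ A.erase a, ((Function.update σ a l x : Fin (n + 1)) : ℕ) =
      ∑ x ∈ A.erase a, (σ x : ℕ) :=
    Finset.sum_congr rfl fun x hx => by rw [Function.update_of_ne (Finset.ne_of_mem_erase hx)]
  rw [hrest, show ((σ a : Fin (n + 1)) : ℕ) = (l : ℕ) + 1 from hl, pow_add, pow_add]
  ring

/-- **`-S⁻_F` preserves the Marshall sign rule** for `F ⊆ A`: the entries of `S⁻_a` are `≥ 0` and
each hop flips the Marshall sign. [folklore] -/
theorem IsMarshallNonneg.neg_lowerOn {F : Finset Λ} (hF : F ⊆ A) {w : TensorIndex Λ (n + 1) → ℂ}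
    (hw : IsMarshallNonneg A w) : IsMarshallNonneg A (-(lowerOn n F *ᵥ w)) := by
  intro σ
  rw [Pi.neg_apply, lowerOn, Matrix.sum_mulVec, Finset.sum_apply]
  simp only [LiebMattis.onSite_mulVec_apply, mul_neg, Finset.mul_sum, ← Finset.sum_neg_distrib]
  -- each term `-(m_σ S⁻_{σ_a l} w(σ[a↦l]))` is a nonnegative real
  have hterm : ∀ a ∈ F, ∀ l : Fin (n + 1),
      0 ≤ (-(marshallSign A σ * (spinLower n (σ a) l * w (Function.update σ a l)))).re ∧
        (-(marshallSign A σ * (spinLower n (σ a) l * w (Function.update σ a l)))).im = 0 := by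
    intro a ha l
    by_cases hl : (σ a).val = l.val + 1
    · have hms := marshallSign_update_of_mem (hF ha) σ hl
      obtain ⟨h1, h2⟩ := hw (Function.update σ a l)
      rw [hms] at h1 h2
      have e : -(marshallSign A σ * (spinLower n (σ a) l * w (Function.update σ a l))) =
          spinLower n (σ a) l * (-marshallSign A σ * w (Function.update σ a l)) := by ring
      rw [e, spinLower_apply, if_pos hl, Complex.re_ofReal_mul, Complex.im_ofReal_mul, h2, mul_zero]
      exact ⟨mul_nonneg (Real.sqrt_nonneg _) h1, rfl⟩
    · rw [spinLower_apply, if_neg hl, zero_mul, mul_zero, neg_zero]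
      simp
  refine ⟨?_, ?_⟩
  · rw [Complex.re_sum]
    exact Finset.sum_nonneg fun a ha => by
      rw [Complex.re_sum]; exact Finset.sum_nonneg fun l _ => (hterm a ha l).1
  · rw [Complex.im_sum]
    exact Finset.sum_eq_zero fun a ha => by
      rw [Complex.im_sum]; exact Finset.sum_eq_zero fun l _ => (hterm a ha l).2

/-- Iterating: `(-S⁻_F)^k w` obeys the Marshall sign rule. [folklore] -/
theorem IsMarshallNonneg.neg_lowerOn_pow {F : Finset Λ} (hF : F ⊆ A) {w : TensorIndex Λ (n + 1) → ℂ}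
    (hw : IsMarshallNonneg A w) (k : ℕ) : IsMarshallNonneg A ((-lowerOn n F) ^ k *ᵥ w) := by
  induction k with
  | zero => simpa using hw
  | succ k ih =>
    rw [pow_succ', ← mulVec_mulVec, neg_mulVec]
    exact ih.neg_lowerOn hF

/-! #### Total lowering of the singlet reference acts only on the unpaired spins -/

/-- Lowering operators of disjoint sets of sites commute. [folklore] -/
theorem commute_lowerOn_of_disjoint {X Y : Finset Λ} (h : Disjoint X Y) :
    Commute (lowerOn n X) (lowerOn n Y) := by
  unfold lowerOn
  refine Commute.sum_left _ _ _ fun x hx => Commute.sum_right _ _ _ fun y hy => ?_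
  exact commute_onSite_onSite (fun hxy => Finset.disjoint_left.1 h hx (by rw [hxy]; exact hy)) _ _

/-- `S⁻_tot = S⁻_F + S⁻_{pairs}`. [folklore] -/
theorem lowerOn_univ_eq_add : lowerOn n (Finset.univ : Finset Λ) =
    lowerOn n (freeSites A e) + lowerOn n (pairedSites A e) := by
  rw [lowerOn, lowerOn, lowerOn, ← compl_freeSites, Finset.sum_add_sum_compl]

/-- **On the singlet reference state, powers of the total lowering operator act only through the
unpaired spins**: `(S⁻_tot)^k R₀ = (S⁻_F)^k R₀`. [folklore] -/
theorem lowerOn_univ_pow_mulVec_refVec (hp : IsPairing A e) (k : ℕ) :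
    (lowerOn n Finset.univ) ^ k *ᵥ refVec n A e (fun _ => 0) =
      (lowerOn n (freeSites A e)) ^ k *ᵥ refVec n A e (fun _ => 0) := by
  induction k with
  | zero => simp
  | succ k ih =>
    have hc : Commute (lowerOn n (pairedSites A e)) (lowerOn n (freeSites A e) ^ k) :=
      (commute_lowerOn_of_disjoint (n := n) (by
        rw [← compl_freeSites]; exact disjoint_compl_left)).pow_right k
    have h0 : lowerOn n (pairedSites A e) *ᵥ
        (lowerOn n (freeSites A e) ^ k *ᵥ refVec n A e fun _ => 0) = 0 := by
      rw [mulVec_mulVec, hc.eq, ← mulVec_mulVec, lowerOn_pairedSites_mulVec_refVec hp, mulVec_zero]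
    rw [pow_succ', ← mulVec_mulVec, ih, lowerOn_univ_eq_add (A := A) (e := e), add_mulVec, h0,
      add_zero, mulVec_mulVec, ← pow_succ']

end Reference

/-! ## VI. The total spin of the sector ground states -/

section Spin

variable {Λ : Type*} [Fintype Λ] [DecidableEq Λ] {n : ℕ}

omit [Fintype Λ] in
/-- Filling a set of sites with labels `≤ n` of prescribed total `t ≤ n |s|`. [folklore] -/
theorem exists_sum_eq (n : ℕ) (s : Finset Λ) :
    ∀ t : ℕ, t ≤ n * s.card → ∃ j : Λ → ℕ, (∀ x, j x ≤ n) ∧ ∑ x ∈ s, j x = t := by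
  induction s using Finset.induction_on with
  | empty =>
    intro t ht
    rw [Finset.card_empty, mul_zero, Nat.le_zero] at ht
    exact ⟨fun _ => 0, fun _ => Nat.zero_le _, by rw [Finset.sum_empty, ht]⟩
  | insert a s ha ih =>
    intro t ht
    rw [Finset.card_insert_of_notMem ha] at ht
    obtain ⟨j, hj, hsum⟩ := ih (t - min t n) (by
      rcases Nat.le_total t n with h | h
      · rw [min_eq_left h]; omega
      · rw [min_eq_right h]; rw [mul_add, mul_one] at ht; omega)
    refine ⟨Function.update j a (min t n), fun x => ?_, ?_⟩
    · by_cases hx : x = a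
      · subst hx; rw [Function.update_self]; exact min_le_right _ _
      · rw [Function.update_of_ne hx]; exact hj x
    · rw [Finset.sum_insert ha, Function.update_self,
        Finset.sum_congr rfl fun x hx => Function.update_of_ne (ne_of_mem_of_not_mem hx ha) _ _, hsum]
      exact Nat.add_sub_cancel' (min_le_left _ _)

omit [DecidableEq Λ] in
/-- The magnetisation in terms of the total label: `mag σ = |Λ| n/2 - Σ_x σ_x`. [folklore] -/
theorem mag_eq (σ : TensorIndex Λ (n + 1)) :
    mag n σ = (Fintype.card Λ : ℝ) * n / 2 - ((∑ x, (σ x).val : ℕ) : ℝ) := by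
  rw [mag, Finset.sum_sub_distrib, Finset.sum_const, Finset.card_univ, nsmul_eq_mul]
  push_cast
  ring

/-- `|Λ| = |A| + |Aᶜ|`, in `ℝ`. [folklore] -/
theorem card_eq_card_add_card_compl (A : Finset Λ) :
    (Fintype.card Λ : ℝ) = A.card + Aᶜ.card := by
  rw [← Finset.card_add_card_compl A]; push_cast; rfl

variable (G : SimpleGraph Λ) [DecidableRel G.Adj] {A : Finset Λ} (J : ℝ)

/-- **Reference vector in a sector `M ≥ S₀`** (`S₀ = (|A| - |Aᶜ|) n/2`, `|Aᶜ| ≤ |A|`): a nonzero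
Marshall-nonnegative vector of `𝓗_M` with `(𝐒_tot)² = M(M+1)` — the product of pair states of
spins `j_b` with `Σ_b j_b = M - S₀` and up-spins on the unpaired sites (a highest-weight vector of
weight `M`). Lieb–Mattis (1962), proof of Thm 2 (ground state of the reference model in the
subspace `M`); Mattis (2006) §5.10, eqs. (5.175)–(5.176). [folklore] -/
theorem exists_reference_of_le (hcard : Aᶜ.card ≤ A.card) {M : ℝ}
    (hM : spinZSector (Λ := Λ) n M ≠ ⊥) (hS₀M : ((A.card : ℝ) - Aᶜ.card) * n / 2 ≤ M) :
    ∃ w : TensorIndex Λ (n + 1) → ℂ, w ∈ spinZSector (Λ := Λ) n M ∧ w ≠ 0 ∧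
      IsMarshallNonneg A w ∧ totalSpinSq n *ᵥ w = ((M * (M + 1) : ℝ) : ℂ) • w := by
  obtain ⟨e, hp⟩ := exists_isPairing A hcard
  obtain ⟨σ, hσ⟩ := (spinZSector_ne_bot_iff n M).1 hM
  have hcardΛ := card_eq_card_add_card_compl A
  have hle : ∑ x, (σ x).val ≤ n * Aᶜ.card := by
    have h1 : ((∑ x, (σ x).val : ℕ) : ℝ) ≤ n * Aᶜ.card := by
      have := mag_eq σ; rw [hσ, hcardΛ] at this; nlinarith
    exact_mod_cast h1
  obtain ⟨j, hj, hsum⟩ := exists_sum_eq n Aᶜ (n * Aᶜ.card - ∑ x, (σ x).val) (Nat.sub_le _ _)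
  have hMeq : ((A.card : ℝ) - Aᶜ.card) * n / 2 + ∑ b ∈ Aᶜ, (j b : ℝ) = M := by
    have h1 : ((∑ b ∈ Aᶜ, j b : ℕ) : ℝ) = n * Aᶜ.card - ((∑ x, (σ x).val : ℕ) : ℝ) := by
      rw [hsum, Nat.cast_sub hle]; push_cast; ring
    push_cast at h1
    rw [h1, ← hσ, mag_eq σ, hcardΛ]; push_cast; ring
  have hmem : refVec n A e j ∈ spinZSector (Λ := Λ) n M := by
    have := refVec_mem_spinZSector (n := n) (j := j) hp; rwa [hMeq] at this
  exact ⟨refVec n A e j, hmem, refVec_ne_zero hp fun b _ => hj b, isMarshallNonneg_refVec hp,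
    totalSpinSq_mulVec_of_highest n (raiseOn_mulVec_refVec hp) hmem⟩

omit [DecidableEq Λ] in
/-- `(-L)^k v = (-1)^k (L^k v)`. [folklore] -/
theorem neg_pow_mulVec {ι : Type*} [Fintype ι] [DecidableEq ι] (L : Matrix ι ι ℂ) (v : ι → ℂ)
    (k : ℕ) : (-L) ^ k *ᵥ v = ((-1 : ℂ) ^ k) • (L ^ k *ᵥ v) := by
  induction k with
  | zero => simp
  | succ k ih =>
    rw [pow_succ' (-L) k, ← mulVec_mulVec, ih, mulVec_smul, neg_mulVec, pow_succ' L k,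
      ← mulVec_mulVec, pow_succ (-1 : ℂ) k, mul_comm ((-1 : ℂ) ^ k) (-1), ← smul_smul, neg_one_smul,
      smul_neg]

/-- **Reference vector in a sector `0 ≤ M < S₀`**: `(-S⁻_F)^{S₀ - M}` applied to the singlet
reference state (all pairs singlets, unpaired spins up: the highest-weight vector of weight `S₀`);
it is a nonzero Marshall-nonnegative vector of `𝓗_M` with `(𝐒_tot)² = S₀(S₀+1)`.
Lieb–Mattis (1962), proof of Thm 2; Mattis (2006) §5.10. [folklore] -/
theorem exists_reference_of_lt (hcard : Aᶜ.card ≤ A.card) {M : ℝ}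
    (hM : spinZSector (Λ := Λ) n M ≠ ⊥) (h0M : 0 ≤ M) (hMS₀ : M < ((A.card : ℝ) - Aᶜ.card) * n / 2) :
    ∃ w : TensorIndex Λ (n + 1) → ℂ, w ∈ spinZSector (Λ := Λ) n M ∧ w ≠ 0 ∧
      IsMarshallNonneg A w ∧ totalSpinSq n *ᵥ w =
        (((((A.card : ℝ) - Aᶜ.card) * n / 2) * (((A.card : ℝ) - Aᶜ.card) * n / 2 + 1) : ℝ) : ℂ) • w := by
  set S₀ : ℝ := ((A.card : ℝ) - Aᶜ.card) * n / 2 with hS₀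
  obtain ⟨e, hp⟩ := exists_isPairing A hcard
  obtain ⟨σ, hσ⟩ := (spinZSector_ne_bot_iff n M).1 hM
  have hcardΛ := card_eq_card_add_card_compl A
  -- the singlet reference state `R` : weight `S₀`, highest weight, spin `S₀`
  set R := refVec n A e (fun _ => 0) with hR
  have hRmem : R ∈ spinZSector (Λ := Λ) n S₀ := by
    have := refVec_mem_spinZSector (n := n) (j := fun _ => 0) hp
    simp only [Nat.cast_zero, Finset.sum_const_zero, add_zero] at this
    exact this
  have hR0 : R ≠ 0 := refVec_ne_zero hp fun _ _ => Nat.zero_le _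
  have hRS : totalSpinSq n *ᵥ R = ((S₀ * (S₀ + 1) : ℝ) : ℂ) • R :=
    totalSpinSq_mulVec_of_highest n (raiseOn_mulVec_refVec hp) hRmem
  -- `S₀ - M` is a natural number `k ≤ S₀`
  have hle : n * Aᶜ.card ≤ ∑ x, (σ x).val := by
    have h1 : (n : ℝ) * Aᶜ.card ≤ ((∑ x, (σ x).val : ℕ) : ℝ) := by
      have := mag_eq σ; rw [hσ, hcardΛ] at this; nlinarith
    exact_mod_cast h1
  set k : ℕ := ∑ x, (σ x).val - n * Aᶜ.card with hk
  have hkM : (k : ℝ) = S₀ - M := by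
    rw [hk, Nat.cast_sub hle, ← hσ, mag_eq σ, hcardΛ]; push_cast; ring
  obtain ⟨h1, h2, h3⟩ := lowerOn_pow_mulVec n hRS hRmem hR0 le_rfl k (by rw [hkM]; linarith)
  rw [show S₀ - k = M by rw [hkM]; ring] at h1
  -- the Marshall-nonnegative version `(-S⁻_F)^k R = (-1)^k (S⁻_tot)^k R`
  refine ⟨(-lowerOn n (freeSites A e)) ^ k *ᵥ R, ?_, ?_,
    (isMarshallNonneg_refVec hp).neg_lowerOn_pow Finset.sdiff_subset k, ?_⟩
  · rw [neg_pow_mulVec, ← lowerOn_univ_pow_mulVec_refVec hp]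
    exact Submodule.smul_mem _ _ h1
  · rw [neg_pow_mulVec, ← lowerOn_univ_pow_mulVec_refVec hp]
    exact smul_ne_zero (pow_ne_zero _ (neg_ne_zero.2 one_ne_zero)) h3
  · rw [neg_pow_mulVec, ← lowerOn_univ_pow_mulVec_refVec hp, mulVec_smul, h2, smul_comm]

/-- **The total spin of the sector ground state** (Lieb–Mattis): for the spin-`n/2` antiferromagnet
on a connected bipartite graph with `|Aᶜ| ≤ |A|`, in every allowed sector `S^z_tot = M ≥ 0` the
(unique) ground state has `(𝐒_tot)² = S(S+1)` with `S = max(S₀, M)`, `S₀ = (|A| - |Aᶜ|) n/2`: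
it has positive overlap with the reference vector of that spin. Lieb–Mattis (1962), Thm 2 and its
proof; Mattis (2006) §5.10; Tasaki (2020) Thm 2.3. [cite: LiebMattis1962, Theorem 2] -/
theorem totalSpinSq_mulVec_groundState (hG : G.Connected) (hA : G.IsBipartiteWith (A : Set Λ) (↑A)ᶜ)
    (hJ : 0 < J) (hcard : Aᶜ.card ≤ A.card) {M : ℝ} (hM : spinZSector (Λ := Λ) n M ≠ ⊥) (h0M : 0 ≤ M)
    {v : TensorIndex Λ (n + 1) → ℂ} (hv : v ∈ spinZSector (Λ := Λ) n M) (hv0 : v ≠ 0)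
    (hHv : heisenbergHamiltonian n G J *ᵥ v =
      ((lowestEnergyInSector n (heisenbergHamiltonian n G J) M : ℝ) : ℂ) • v) :
    totalSpinSq n *ᵥ v =
      ((max (((A.card : ℝ) - Aᶜ.card) * n / 2) M * (max (((A.card : ℝ) - Aᶜ.card) * n / 2) M + 1) : ℝ) : ℂ) • v := by
  set S₀ : ℝ := ((A.card : ℝ) - Aᶜ.card) * n / 2 with hS₀
  -- a Marshall-nonnegative reference vector of spin `max S₀ M` in the sector
  obtain ⟨w, hwM, hw0, hwms, hwS⟩ : ∃ w : TensorIndex Λ (n + 1) → ℂ, w ∈ spinZSector (Λ := Λ) n M ∧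
      w ≠ 0 ∧ IsMarshallNonneg A w ∧
      totalSpinSq n *ᵥ w = ((max S₀ M * (max S₀ M + 1) : ℝ) : ℂ) • w := by
    rcases le_or_gt S₀ M with hle | hlt
    · rw [max_eq_right hle]; exact exists_reference_of_le hcard hM hle
    · rw [max_eq_left hlt.le]; exact exists_reference_of_lt hcard hM h0M hlt
  obtain ⟨c, hc⟩ := exists_totalSpinSq_mulVec_eq_smul G J hG hA hJ hM hv hv0 hHv
  obtain ⟨c', -, hpos⟩ := liebMattis_sector_pos G J hG hA hJ hM hv hv0 hHv
  have hvw : star w ⬝ᵥ v ≠ 0 :=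
    dotProduct_ne_zero_of_marshall (p := fun σ => mag n σ = M) hwms
      ((mem_spinZSector_iff n M w).1 hwM) hw0 hpos
  have hcμ := eigenvalue_eq_of_dotProduct_ne_zero (totalSpinSq_isHermitian n) hc hwS hvw
  rw [hc, hcμ]

end Spin

/-! ## VII. Ordering of the sector energies -/

section Energies

variable {Λ : Type*} [Fintype Λ] [DecidableEq Λ] {n : ℕ} (G : SimpleGraph Λ) [DecidableRel G.Adj] (J : ℝ)

/-- **Variational bound**: an eigenvector of `H` in `𝓗_M` with eigenvalue `E'` shows `E(M) ≤ E'`.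
Tasaki (2020) §2.1–2.2. [folklore] -/
theorem lowestEnergy_le_of_eigenvector {M E' : ℝ} {w : TensorIndex Λ (n + 1) → ℂ}
    (hw : w ∈ spinZSector (Λ := Λ) n M) (hw0 : w ≠ 0)
    (hHw : heisenbergHamiltonian n G J *ᵥ w = (E' : ℂ) • w) :
    lowestEnergyInSector n (heisenbergHamiltonian n G J) M ≤ E' := by
  have hM : spinZSector (Λ := Λ) n M ≠ ⊥ := (Submodule.ne_bot_iff _).2 ⟨w, hw, hw0⟩
  have h := (liebMattis_sector_groundState G J hM).2 w hw
  rw [hHw, dotProduct_smul, smul_eq_mul, Complex.re_ofReal_mul] at h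
  have hpos : 0 < (star w ⬝ᵥ w).re := (Complex.pos_iff.1 (dotProduct_star_self_pos_iff.2 hw0)).1
  exact le_of_mul_le_mul_right h hpos

/-- **The ground energy is below every sector energy**: `E₀ ≤ E(M)` for allowed `M`. Tasaki (2020)
§2.1, eq. (2.1.6). [folklore] -/
theorem groundEnergy_le_lowestEnergy {M : ℝ} (hM : spinZSector (Λ := Λ) n M ≠ ⊥) :
    (heisenbergHamiltonian n G J).groundEnergy ≤ lowestEnergyInSector n (heisenbergHamiltonian n G J) M := by
  obtain ⟨⟨v, -, hv0, hHv⟩, -⟩ := liebMattis_sector_groundState G J hM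
  obtain ⟨c, -, hc1⟩ := exists_smul_unit hv0
  have h := Matrix.groundEnergy_le_rayleigh_holds (heisenbergHamiltonian_isHermitian n G J) (c • v) hc1
  rwa [mulVec_smul, hHv, smul_comm, dotProduct_smul, hc1, smul_eq_mul, mul_one, Complex.ofReal_re] at h

/-! ### The spin flip `σ ↦ n - σ` (all `m_x ↦ -m_x`): `E(-M) = E(M)` -/

/-- The spin-flipped configuration `σ_x ↦ n - σ_x` (`m_x ↦ -m_x` at every site; the `π`-rotation
of all spins about the `x`-axis). Tasaki (2020) §2.1, eq. (2.1.26). [folklore] -/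
def flipCfg (σ : TensorIndex Λ (n + 1)) : TensorIndex Λ (n + 1) := fun x => (σ x).rev

omit [Fintype Λ] [DecidableEq Λ] in
/-- The flip is an involution. [folklore] -/
theorem flipCfg_flipCfg (σ : TensorIndex Λ (n + 1)) : flipCfg (flipCfg σ) = σ :=
  funext fun _ => Fin.rev_rev _

/-- The flip as a permutation of the configurations. [folklore] -/
def flipEquiv : TensorIndex Λ (n + 1) ≃ TensorIndex Λ (n + 1) :=
  Function.Involutive.toPerm flipCfg flipCfg_flipCfg

omit [DecidableEq Λ] in
/-- The flip reverses the magnetisation. [folklore] -/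
theorem mag_flipCfg (σ : TensorIndex Λ (n + 1)) : mag n (flipCfg σ) = -mag n σ := by
  rw [mag, mag, ← Finset.sum_neg_distrib]
  refine Finset.sum_congr rfl fun x _ => ?_
  change (n : ℝ) / 2 - (((σ x).rev : ℕ) : ℝ) = _
  rw [natCast_val_rev_real]; ring

/-- **The Heisenberg Hamiltonian is flip invariant**: `⟨flip σ|H|flip τ⟩ = ⟨σ|H|τ⟩` (under the flip
`S⁺ ↔ S⁻`, `S^z ↦ -S^z`, and `𝐒_x·𝐒_y = ½(S⁺S⁻ + S⁻S⁺) + S^zS^z` is unchanged). Tasaki (2020) §2.1,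
eq. (2.1.26); §2.4. [folklore] -/
theorem heisenberg_apply_flipCfg (σ τ : TensorIndex Λ (n + 1)) :
    heisenbergHamiltonian n G J (flipCfg σ) (flipCfg τ) = heisenbergHamiltonian n G J σ τ := by
  rw [LiebMattis.heisenbergHamiltonian_apply, LiebMattis.heisenbergHamiltonian_apply]
  congr 1
  refine Finset.sum_congr rfl fun e he => ?_
  revert he
  refine Sym2.ind (fun x y hxy => ?_) e
  rw [SimpleGraph.mem_edgeFinset, SimpleGraph.mem_edgeSet] at hxy
  have hne := G.ne_of_adj hxy
  rw [spinDotSym_mk, spinDot_apply_of_ne n hne, spinDot_apply_of_ne n hne]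
  have hc : (∀ z, z ≠ x → z ≠ y → flipCfg σ z = flipCfg τ z) ↔ (∀ z, z ≠ x → z ≠ y → σ z = τ z) :=
    forall_congr' fun z => imp_congr_right fun _ => imp_congr_right fun _ => Fin.rev_inj
  rw [if_congr hc rfl rfl]
  split_ifs
  · simp only [flipCfg, spinRaise_rev_rev, spinLower_rev_rev, spinZ_rev_rev]
    ring
  · rfl

/-- `H` commutes with the flip on vectors: `H (ψ ∘ flip) = (H ψ) ∘ flip`. [folklore] -/
theorem heisenberg_mulVec_comp_flipCfg (ψ : TensorIndex Λ (n + 1) → ℂ) :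
    heisenbergHamiltonian n G J *ᵥ (ψ ∘ flipCfg) = (heisenbergHamiltonian n G J *ᵥ ψ) ∘ flipCfg := by
  funext σ
  simp only [Function.comp_apply, mulVec, dotProduct]
  conv_rhs => rw [← Equiv.sum_comp (flipEquiv (Λ := Λ) (n := n))]
  refine Finset.sum_congr rfl fun τ _ => ?_
  change _ = heisenbergHamiltonian n G J (flipCfg σ) (flipCfg τ) * ψ (flipCfg τ)
  rw [heisenberg_apply_flipCfg]

/-- Inner products are flip invariant. [folklore] -/
theorem dotProduct_comp_flipCfg (ψ φ : TensorIndex Λ (n + 1) → ℂ) :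
    star (ψ ∘ flipCfg) ⬝ᵥ (φ ∘ flipCfg) = star ψ ⬝ᵥ φ := by
  simp only [dotProduct]
  conv_rhs => rw [← Equiv.sum_comp (flipEquiv (Λ := Λ) (n := n))]
  rfl

/-- The flip maps `𝓗_M` to `𝓗_{-M}`. [folklore] -/
theorem comp_flipCfg_mem {M : ℝ} {ψ : TensorIndex Λ (n + 1) → ℂ} (hψ : ψ ∈ spinZSector (Λ := Λ) n M) :
    ψ ∘ flipCfg ∈ spinZSector (Λ := Λ) n (-M) := by
  rw [mem_spinZSector_iff] at hψ ⊢
  intro σ hσ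
  exact hψ _ (by rw [mag_flipCfg]; intro h; exact hσ (by linarith))

omit [Fintype Λ] [DecidableEq Λ] in
/-- The flip of a nonzero vector is nonzero. [folklore] -/
theorem comp_flipCfg_ne_zero {ψ : TensorIndex Λ (n + 1) → ℂ} (hψ : ψ ≠ 0) : ψ ∘ flipCfg ≠ 0 := by
  intro h
  apply hψ
  funext σ
  have := congrFun h (flipCfg σ)
  rwa [Function.comp_apply, flipCfg_flipCfg] at this

/-- `-M` is allowed iff `M` is. [folklore] -/
theorem spinZSector_neg_ne_bot {M : ℝ} (hM : spinZSector (Λ := Λ) n M ≠ ⊥) :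
    spinZSector (Λ := Λ) n (-M) ≠ ⊥ := by
  rw [spinZSector_ne_bot_iff] at hM ⊢
  obtain ⟨σ, hσ⟩ := hM
  exact ⟨flipCfg σ, by rw [mag_flipCfg, hσ]⟩

/-- `E(-M) ≤ E(M)` for allowed `M` (flip the sector ground state). [folklore] -/
theorem lowestEnergy_neg_le {M : ℝ} (hM : spinZSector (Λ := Λ) n M ≠ ⊥) :
    lowestEnergyInSector n (heisenbergHamiltonian n G J) (-M) ≤
      lowestEnergyInSector n (heisenbergHamiltonian n G J) M := by
  obtain ⟨⟨v, hv, hv0, hHv⟩, -⟩ := liebMattis_sector_groundState G J hM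
  refine lowestEnergy_le_of_eigenvector G J (comp_flipCfg_mem hv) (comp_flipCfg_ne_zero hv0) ?_
  rw [heisenberg_mulVec_comp_flipCfg, hHv]
  rfl

/-- **`E(-M) = E(M)`** (spin-flip symmetry) for allowed `M`. Lieb–Mattis (1962) §II. [folklore] -/
theorem lowestEnergy_neg {M : ℝ} (hM : spinZSector (Λ := Λ) n M ≠ ⊥) :
    lowestEnergyInSector n (heisenbergHamiltonian n G J) (-M) =
      lowestEnergyInSector n (heisenbergHamiltonian n G J) M := by
  refine le_antisymm (lowestEnergy_neg_le G J hM) ?_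
  have := lowestEnergy_neg_le G J (spinZSector_neg_ne_bot hM)
  rwa [neg_neg] at this

/-- `|M|` is allowed and `E(M) = E(|M|)`, for allowed `M`. [folklore] -/
theorem lowestEnergy_abs {M : ℝ} (hM : spinZSector (Λ := Λ) n M ≠ ⊥) :
    spinZSector (Λ := Λ) n |M| ≠ ⊥ ∧
      lowestEnergyInSector n (heisenbergHamiltonian n G J) M =
        lowestEnergyInSector n (heisenbergHamiltonian n G J) |M| := by
  rcases le_or_gt 0 M with h | h
  · rw [abs_of_nonneg h]; exact ⟨hM, rfl⟩
  · rw [abs_of_neg h]; exact ⟨spinZSector_neg_ne_bot hM, (lowestEnergy_neg G J hM).symm⟩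

/-! ### A ground state lives in some sector -/

/-- **Some sector ground state is an absolute ground state**: there is an allowed `M ≥ 0` and a
nonzero `v ∈ 𝓗_M` with `H v = E₀ v` (project a ground state to a sector where it is nonzero — `H` is
block diagonal — and flip if `M < 0`). Tasaki (2020) §2.4; Lieb–Mattis (1962) §II. [folklore] -/
theorem exists_sector_groundState_nonneg :
    ∃ M : ℝ, 0 ≤ M ∧ spinZSector (Λ := Λ) n M ≠ ⊥ ∧ ∃ v ∈ spinZSector (Λ := Λ) n M, v ≠ 0 ∧
      heisenbergHamiltonian n G J *ᵥ v = (((heisenbergHamiltonian n G J).groundEnergy : ℝ) : ℂ) • v := by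
  -- a ground state and a configuration in its support
  obtain ⟨ψ, hψ, hψ0⟩ := (Submodule.ne_bot_iff _).1
    (Matrix.groundSpace_ne_bot_holds (heisenbergHamiltonian_isHermitian n G J))
  rw [Matrix.mem_groundSpace_iff] at hψ
  obtain ⟨σ₀, hσ₀⟩ := Function.ne_iff.1 hψ0
  -- its component in the sector of `σ₀`
  have key : ∀ M : ℝ, (∃ σ, mag n σ = M ∧ ψ σ ≠ 0) → ∃ v ∈ spinZSector (Λ := Λ) n M, v ≠ 0 ∧
      heisenbergHamiltonian n G J *ᵥ v =
        (((heisenbergHamiltonian n G J).groundEnergy : ℝ) : ℂ) • v := by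
    rintro M ⟨σ₁, hσ₁, hψσ₁⟩
    refine ⟨fun σ => if mag n σ = M then ψ σ else 0, (mem_spinZSector_iff n M _).2 fun σ hσ => if_neg hσ,
      fun h => hψσ₁ (by have := congrFun h σ₁; rwa [if_pos hσ₁] at this), ?_⟩
    funext σ
    rw [Pi.smul_apply, smul_eq_mul, mulVec, dotProduct]
    by_cases hσ : mag n σ = M
    · rw [if_pos hσ]
      have h1 := congrFun hψ σ
      rw [Pi.smul_apply, smul_eq_mul, mulVec, dotProduct] at h1
      rw [← h1]
      refine Finset.sum_congr rfl fun τ _ => ?_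
      by_cases hτ : mag n τ = M
      · rw [if_pos hτ]
      · rw [if_neg hτ, mul_zero, heisenberg_apply_eq_zero_of_mag_ne n G J (by rw [hσ]; exact Ne.symm hτ),
          zero_mul]
    · rw [if_neg hσ, mul_zero]
      refine Finset.sum_eq_zero fun τ _ => ?_
      by_cases hτ : mag n τ = M
      · rw [heisenberg_apply_eq_zero_of_mag_ne n G J (by rw [hτ]; exact hσ), zero_mul]
      · rw [if_neg hτ, mul_zero]
  rcases le_or_gt 0 (mag n σ₀) with h0 | h0
  · obtain ⟨v, hv, hv0, hHv⟩ := key (mag n σ₀) ⟨σ₀, rfl, hσ₀⟩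
    exact ⟨mag n σ₀, h0, (Submodule.ne_bot_iff _).2 ⟨v, hv, hv0⟩, v, hv, hv0, hHv⟩
  · obtain ⟨v, hv, hv0, hHv⟩ := key (mag n σ₀) ⟨σ₀, rfl, hσ₀⟩
    refine ⟨-mag n σ₀, by linarith, (Submodule.ne_bot_iff _).2 ⟨_, comp_flipCfg_mem hv,
      comp_flipCfg_ne_zero hv0⟩, v ∘ flipCfg, comp_flipCfg_mem hv, comp_flipCfg_ne_zero hv0, ?_⟩
    rw [heisenberg_mulVec_comp_flipCfg, hHv]
    rfl

/-! ### Allowed magnetisations: steps of one -/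

/-- Two allowed magnetisations `M ≤ M'` differ by a natural number. [folklore] -/
theorem exists_nat_of_allowed_le {M M' : ℝ} (hM : spinZSector (Λ := Λ) n M ≠ ⊥)
    (hM' : spinZSector (Λ := Λ) n M' ≠ ⊥) (h : M ≤ M') : ∃ k : ℕ, M' = M + k := by
  obtain ⟨σ, hσ⟩ := (spinZSector_ne_bot_iff n M).1 hM
  obtain ⟨σ', hσ'⟩ := (spinZSector_ne_bot_iff n M').1 hM'
  have e := mag_eq σ
  have e' := mag_eq σ'
  rw [hσ] at e
  rw [hσ'] at e'
  have hle : ∑ x, (σ' x).val ≤ ∑ x, (σ x).val := by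
    have : ((∑ x, (σ' x).val : ℕ) : ℝ) ≤ ((∑ x, (σ x).val : ℕ) : ℝ) := by linarith
    exact_mod_cast this
  refine ⟨∑ x, (σ x).val - ∑ x, (σ' x).val, ?_⟩
  rw [Nat.cast_sub hle]; linarith

/-- An allowed magnetisation is at most `S_max = |Λ| n/2`. [folklore] -/
theorem le_of_allowed {M : ℝ} (hM : spinZSector (Λ := Λ) n M ≠ ⊥) : M ≤ (Fintype.card Λ : ℝ) * n / 2 := by
  obtain ⟨σ, hσ⟩ := (spinZSector_ne_bot_iff n M).1 hM
  rw [← hσ, mag_eq]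
  have : (0 : ℝ) ≤ ((∑ x, (σ x).val : ℕ) : ℝ) := Nat.cast_nonneg _
  linarith

/-- One step up: if `M` is allowed and `M + 1 ≤ S_max` then `M + 1` is allowed (lower one label).
[folklore] -/
theorem allowed_add_one {M : ℝ} (hM : spinZSector (Λ := Λ) n M ≠ ⊥)
    (h : M + 1 ≤ (Fintype.card Λ : ℝ) * n / 2) : spinZSector (Λ := Λ) n (M + 1) ≠ ⊥ := by
  obtain ⟨σ, hσ⟩ := (spinZSector_ne_bot_iff n M).1 hM
  have hsum : 1 ≤ ∑ x, (σ x).val := by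
    have e := mag_eq σ
    rw [hσ] at e
    have : (1 : ℝ) ≤ ((∑ x, (σ x).val : ℕ) : ℝ) := by linarith
    exact_mod_cast this
  obtain ⟨x, hx⟩ : ∃ x, 0 < (σ x).val := by
    by_contra hc
    push Not at hc
    have : ∑ x, (σ x).val = 0 := Finset.sum_eq_zero fun x _ => Nat.le_zero.1 (hc x)
    omega
  rw [spinZSector_ne_bot_iff]
  refine ⟨Function.update σ x ⟨(σ x).val - 1, by omega⟩, ?_⟩
  have e1 : ∀ ρ : TensorIndex Λ (n + 1), ∑ z, (ρ z).val = (ρ x).val + ∑ z ∈ Finset.univ.erase x, (ρ z).val :=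
    fun ρ => (Finset.add_sum_erase _ _ (Finset.mem_univ x)).symm
  have e2 : ∑ z, (Function.update σ x ⟨(σ x).val - 1, by omega⟩ z).val + 1 = ∑ z, (σ z).val := by
    rw [e1, e1 σ, Function.update_self, Finset.sum_congr rfl fun z hz =>
      by rw [Function.update_of_ne (Finset.ne_of_mem_erase hz)]]
    change (σ x).val - 1 + _ + 1 = _
    omega
  rw [mag_eq, ← hσ, mag_eq]
  have e3 : ((∑ z, (σ z).val : ℕ) : ℝ) = ((∑ z, (Function.update σ x ⟨(σ x).val - 1, by omega⟩ z).val : ℕ) : ℝ) + 1 := by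
    exact_mod_cast e2.symm
  rw [e3]; ring

/-- Several steps up. [folklore] -/
theorem allowed_add_nat {M : ℝ} (hM : spinZSector (Λ := Λ) n M ≠ ⊥) (k : ℕ)
    (h : M + k ≤ (Fintype.card Λ : ℝ) * n / 2) : spinZSector (Λ := Λ) n (M + k) ≠ ⊥ := by
  induction k with
  | zero => simpa using hM
  | succ k ih =>
    have h' : M + k ≤ (Fintype.card Λ : ℝ) * n / 2 := by push_cast at h; linarith
    have := allowed_add_one (ih h') (by push_cast at h; linarith)
    push_cast
    rwa [add_assoc] at this

/-! ### Moving eigenvectors between sectors -/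

/-- **Lowering transfers energies**: from an eigenvector of `H` of total spin `S`, weight `M₁ ≤ S`
and eigenvalue `E'`, `E(M₁ - k) ≤ E'` for `k < M₁ + S + 1` (apply `(S⁻_tot)^k`, which commutes with
`H` and does not annihilate it). Lieb–Mattis (1962), proof of Thm 2; Tasaki (2020) §2.4. [folklore] -/
theorem lowestEnergy_sub_le {M₁ E' S : ℝ} {v : TensorIndex Λ (n + 1) → ℂ}
    (hv : v ∈ spinZSector (Λ := Λ) n M₁) (hv0 : v ≠ 0)
    (hHv : heisenbergHamiltonian n G J *ᵥ v = (E' : ℂ) • v)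
    (hS : totalSpinSq n *ᵥ v = ((S * (S + 1) : ℝ) : ℂ) • v) (hMS : M₁ ≤ S) (k : ℕ)
    (hk : (k : ℝ) < M₁ + S + 1) :
    lowestEnergyInSector n (heisenbergHamiltonian n G J) (M₁ - k) ≤ E' := by
  obtain ⟨h1, -, h3⟩ := lowerOn_pow_mulVec n hS hv hv0 hMS k hk
  refine lowestEnergy_le_of_eigenvector G J h1 h3 ?_
  rw [mulVec_mulVec, ((commute_heisenberg_lowerOn n G J).pow_right k).eq, ← mulVec_mulVec, hHv,
    mulVec_smul]

/-- **Raising transfers energies**: `E(M₁ + k) ≤ E'` for `k < S - M₁ + 1`, `-S ≤ M₁`. [folklore] -/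
theorem lowestEnergy_add_le {M₁ E' S : ℝ} {v : TensorIndex Λ (n + 1) → ℂ}
    (hv : v ∈ spinZSector (Λ := Λ) n M₁) (hv0 : v ≠ 0)
    (hHv : heisenbergHamiltonian n G J *ᵥ v = (E' : ℂ) • v)
    (hS : totalSpinSq n *ᵥ v = ((S * (S + 1) : ℝ) : ℂ) • v) (hMS : -S ≤ M₁) (k : ℕ)
    (hk : (k : ℝ) < S - M₁ + 1) :
    lowestEnergyInSector n (heisenbergHamiltonian n G J) (M₁ + k) ≤ E' := by
  obtain ⟨h1, -, h3⟩ := raiseOn_pow_mulVec n hS hv hv0 hMS k hk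
  refine lowestEnergy_le_of_eigenvector G J h1 h3 ?_
  rw [mulVec_mulVec, ((commute_heisenberg_raiseOn n G J).pow_right k).eq, ← mulVec_mulVec, hHv,
    mulVec_smul]

variable {A : Finset Λ}

/-- **Strict monotonicity step**: `E(M) < E(M+1)` for allowed `M, M+1` with `S₀ ≤ M`
(`|Aᶜ| ≤ |A|`): lowering the ground state of `𝓗_{M+1}` (spin `M+1`) gives a competitor in `𝓗_M`
of energy `E(M+1)`; equality would make it the ground state of `𝓗_M`, whose spin is `M`.
Lieb–Mattis (1962), Thm 2 ("`E(S+1) > E(S)` for `S ≥ 𝒮`"); Mattis (2006) §5.10, eq. (5.177).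
[cite: LiebMattis1962, Theorem 2] -/
theorem lowestEnergy_lt_add_one (hG : G.Connected) (hA : G.IsBipartiteWith (A : Set Λ) (↑A)ᶜ)
    (hJ : 0 < J) (hcard : Aᶜ.card ≤ A.card) {M : ℝ} (hM : spinZSector (Λ := Λ) n M ≠ ⊥)
    (hM1 : spinZSector (Λ := Λ) n (M + 1) ≠ ⊥) (hS₀M : ((A.card : ℝ) - Aᶜ.card) * n / 2 ≤ M) :
    lowestEnergyInSector n (heisenbergHamiltonian n G J) M <
      lowestEnergyInSector n (heisenbergHamiltonian n G J) (M + 1) := by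
  set S₀ : ℝ := ((A.card : ℝ) - Aᶜ.card) * n / 2 with hS₀def
  have hS₀ : 0 ≤ S₀ := by
    have : (Aᶜ.card : ℝ) ≤ A.card := by exact_mod_cast hcard
    rw [hS₀def]; exact div_nonneg (mul_nonneg (by linarith) (Nat.cast_nonneg n)) zero_le_two
  have h0M : 0 ≤ M := le_trans hS₀ hS₀M
  obtain ⟨⟨v, hv, hv0, hHv⟩, -⟩ := liebMattis_sector_groundState G J hM1
  have hspin := totalSpinSq_mulVec_groundState G J hG hA hJ hcard hM1 (by linarith) hv hv0 hHv
  rw [max_eq_right (by linarith : S₀ ≤ M + 1)] at hspin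
  set u := lowerOn n Finset.univ *ᵥ v with hu_def
  have hu : u ∈ spinZSector (Λ := Λ) n M := by
    have := lowerOn_mulVec_mem n hv; rwa [add_sub_cancel_right] at this
  have hu0 : u ≠ 0 := lowerOn_mulVec_ne_zero n hspin hv hv0 (by linarith) le_rfl
  have hHu : heisenbergHamiltonian n G J *ᵥ u =
      ((lowestEnergyInSector n (heisenbergHamiltonian n G J) (M + 1) : ℝ) : ℂ) • u := by
    rw [hu_def, mulVec_mulVec, (commute_heisenberg_lowerOn n G J).eq, ← mulVec_mulVec, hHv, mulVec_smul]
  have hle := lowestEnergy_le_of_eigenvector G J hu hu0 hHu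
  refine lt_of_le_of_ne hle fun heq => ?_
  rw [← heq] at hHu
  have hspin' := totalSpinSq_mulVec_groundState G J hG hA hJ hcard hM h0M hu hu0 hHu
  rw [max_eq_right hS₀M] at hspin'
  have hSu : totalSpinSq n *ᵥ u = (((M + 1) * (M + 1 + 1) : ℝ) : ℂ) • u := by
    rw [hu_def, mulVec_mulVec, (commute_totalSpinSq_lowerOn n).eq, ← mulVec_mulVec, hspin, mulVec_smul]
  have hdiff := hspin'.symm.trans hSu
  rw [← sub_eq_zero, ← sub_smul, smul_eq_zero] at hdiff
  rcases hdiff with h | h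
  · rw [sub_eq_zero] at h
    have h' : M * (M + 1) = (M + 1) * (M + 1 + 1) := by exact_mod_cast h
    nlinarith
  · exact hu0 h

/-- **Strict monotonicity above `S₀`**: `E(M) < E(M')` for allowed `S₀ ≤ M < M'`.
Lieb–Mattis (1962), Thm 2. [cite: LiebMattis1962, Theorem 2] -/
theorem lowestEnergy_lt_of_lt (hG : G.Connected) (hA : G.IsBipartiteWith (A : Set Λ) (↑A)ᶜ)
    (hJ : 0 < J) (hcard : Aᶜ.card ≤ A.card) {M M' : ℝ} (hM : spinZSector (Λ := Λ) n M ≠ ⊥)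
    (hM' : spinZSector (Λ := Λ) n M' ≠ ⊥) (hS₀M : ((A.card : ℝ) - Aᶜ.card) * n / 2 ≤ M)
    (hlt : M < M') :
    lowestEnergyInSector n (heisenbergHamiltonian n G J) M <
      lowestEnergyInSector n (heisenbergHamiltonian n G J) M' := by
  obtain ⟨k, rfl⟩ := exists_nat_of_allowed_le hM hM' hlt.le
  have hmax := le_of_allowed hM'
  have hk : 1 ≤ k := by
    rcases Nat.eq_zero_or_pos k with h | h
    · subst h; simp at hlt
    · exact h
  clear hlt hM'
  induction k, hk using Nat.le_induction with
  | base =>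
    push_cast at hmax ⊢
    exact lowestEnergy_lt_add_one G J hG hA hJ hcard hM (allowed_add_one hM hmax) hS₀M
  | succ k hk ih =>
    have hmax' : M + k ≤ (Fintype.card Λ : ℝ) * n / 2 := by push_cast at hmax; linarith
    have hMk : spinZSector (Λ := Λ) n (M + k) ≠ ⊥ := allowed_add_nat hM k hmax'
    have h1 := ih hmax'
    have hMk1 : spinZSector (Λ := Λ) n (M + k + 1) ≠ ⊥ :=
      allowed_add_one hMk (by push_cast at hmax; linarith)
    have h2 := lowestEnergy_lt_add_one G J hG hA hJ hcard hMk hMk1 (by linarith)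
    push_cast
    rw [← add_assoc]
    exact h1.trans h2

/-- **Degeneracy below `S₀`**: `E(M) = E₀` for allowed `0 ≤ M ≤ S₀` (`|Aᶜ| ≤ |A|`): an absolute
ground state has a nonzero component in some sector `M₁ ≥ 0`, whose ground state has spin
`max(S₀, M₁) ≥ M`, and raising/lowering it reaches `𝓗_M` without changing the energy.
Lieb–Mattis (1962), Thm 2 ("the ground state belongs to `S ≤ 𝒮`" and `E(S)` minimal for `S ≤ 𝒮`);
Tasaki (2020) Thm 2.3. [cite: LiebMattis1962, Theorem 2] -/
theorem lowestEnergy_eq_groundEnergy (hG : G.Connected) (hA : G.IsBipartiteWith (A : Set Λ) (↑A)ᶜ)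
    (hJ : 0 < J) (hcard : Aᶜ.card ≤ A.card) {M : ℝ} (hM : spinZSector (Λ := Λ) n M ≠ ⊥)
    (h0M : 0 ≤ M) (hMS₀ : M ≤ ((A.card : ℝ) - Aᶜ.card) * n / 2) :
    lowestEnergyInSector n (heisenbergHamiltonian n G J) M = (heisenbergHamiltonian n G J).groundEnergy := by
  set S₀ : ℝ := ((A.card : ℝ) - Aᶜ.card) * n / 2 with hS₀def
  refine le_antisymm ?_ (groundEnergy_le_lowestEnergy G J hM)
  obtain ⟨M₁, h0M₁, hM₁, v, hv, hv0, hHv⟩ := exists_sector_groundState_nonneg G J (n := n)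
  have hE₁ : lowestEnergyInSector n (heisenbergHamiltonian n G J) M₁ =
      (heisenbergHamiltonian n G J).groundEnergy :=
    le_antisymm (lowestEnergy_le_of_eigenvector G J hv hv0 hHv) (groundEnergy_le_lowestEnergy G J hM₁)
  have hHv' : heisenbergHamiltonian n G J *ᵥ v =
      ((lowestEnergyInSector n (heisenbergHamiltonian n G J) M₁ : ℝ) : ℂ) • v := by rw [hE₁]; exact hHv
  have hspin := totalSpinSq_mulVec_groundState G J hG hA hJ hcard hM₁ h0M₁ hv hv0 hHv'
  have hS₁ : S₀ ≤ max S₀ M₁ := le_max_left _ _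
  have hS₁' : M₁ ≤ max S₀ M₁ := le_max_right _ _
  rcases le_or_gt M M₁ with hle | hlt
  · obtain ⟨k, hk⟩ := exists_nat_of_allowed_le hM hM₁ hle
    have := lowestEnergy_sub_le G J hv hv0 hHv hspin hS₁' k (by linarith)
    rwa [show M₁ - k = M by linarith] at this
  · obtain ⟨k, hk⟩ := exists_nat_of_allowed_le hM₁ hM hlt.le
    have := lowestEnergy_add_le G J hv hv0 hHv hspin (by linarith) k (by linarith)
    rwa [← hk] at this

end Energies

/-! ## VIII. The discharge -/

section Discharge

variable {Λ : Type*} [Fintype Λ] [DecidableEq Λ] (n : ℕ) (G : SimpleGraph Λ) [DecidableRel G.Adj]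
  (A : Finset Λ) (J : ℝ)

/-- **Lieb–Mattis, main case `|Aᶜ| ≤ |A|`.** [cite: LiebMattis1962, Theorem 2] -/
theorem lieb_mattis_monotone_of_card_le (hcard : Aᶜ.card ≤ A.card) : lieb_mattis_monotone n G A J := by
  intro hG hA hJ
  have hS₀ : liebMattisSpin n A = ((A.card : ℝ) - Aᶜ.card) * n / 2 := by
    have hc : (Aᶜ.card : ℝ) ≤ A.card := by exact_mod_cast hcard
    rw [liebMattisSpin, abs_of_nonneg (by linarith)]
  rw [hS₀]
  constructor
  · intro M hM hMabs
    obtain ⟨hMa, hEa⟩ := lowestEnergy_abs G J hM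
    rw [hEa]
    exact lowestEnergy_eq_groundEnergy G J hG hA hJ hcard hMa (abs_nonneg M) hMabs
  · intro M M' hM hM' h1 h2
    obtain ⟨hMa, hEa⟩ := lowestEnergy_abs G J hM
    obtain ⟨hMa', hEa'⟩ := lowestEnergy_abs G J hM'
    rw [hEa, hEa']
    exact lowestEnergy_lt_of_lt G J hG hA hJ hcard hMa hMa' h1 h2

/-- **Lieb–Mattis ordering of energy levels (hubbard.S20; discharge of `lieb_mattis_monotone`).**
For the spin-`n/2` Heisenberg antiferromagnet (`J > 0`) on a finite connected bipartite graph with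
sublattices `A`, `Aᶜ` and `S₀ = |(|A| - |Aᶜ|)| n/2`: the sector energies `E(M)` (lowest energy with
`S^z_tot = M`) satisfy `E(M) = E₀` for `|M| ≤ S₀` and `E(M) < E(M')` for `S₀ ≤ |M| < |M'|`.
Proof (Lieb–Mattis 1962, Thm 2; Marshall 1955; Mattis 2006 §5.10; Tasaki 2020 Thm 2.3): in each
sector the Marshall-twisted Hamiltonian has nonpositive off-diagonal entries and a connected hop
graph, so (Perron–Frobenius) the sector ground state is unique and Marshall-positive; it overlaps a
Marshall-nonnegative product of two-site highest-weight states of total spin `max(S₀, |M|)`, which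
is therefore its spin; moving ground states between sectors with `S^±_tot` gives the (in)equalities.
The case `|A| < |Aᶜ|` follows by exchanging the sublattices. [cite: LiebMattis1962, Theorem 2] -/
theorem lieb_mattis_monotone_holds : lieb_mattis_monotone n G A J := by
  by_cases hcard : Aᶜ.card ≤ A.card
  · exact lieb_mattis_monotone_of_card_le n G A J hcard
  · intro hG hA hJ
    have hcard' : Aᶜᶜ.card ≤ Aᶜ.card := by rw [compl_compl]; omega
    have hA' : G.IsBipartiteWith (↑(Aᶜ) : Set Λ) (↑(Aᶜ))ᶜ := by
      rw [Finset.coe_compl, compl_compl]; exact hA.symm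
    have h := lieb_mattis_monotone_of_card_le n G Aᶜ J hcard' hG hA' hJ
    have hspin : liebMattisSpin n Aᶜ = liebMattisSpin n A := by
      rw [liebMattisSpin, liebMattisSpin, compl_compl, abs_sub_comm]
    rw [hspin] at h
    exact h

end Discharge

end Literature.MathematicalPhysics.QuantumLattice
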